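import Literature.Analysis.FluidPDE.PeriodicNSOrbitPersists
import Literature.Analysis.FluidPDE.TimePeriodicNSLatticeRealize
import Literature.Analysis.FluidPDE.TimePeriodicNSLatticeCompact
import Literature.Analysis.FluidPDE.TimePeriodicNSLatticeRegularity
import Literature.Analysis.FunctionSpaces.TorusLerayHelmholtzProofs
import HarnessLib

/-!
# Persistence of time-periodic Navier–Stokes orbits on `T³` under perturbation of the force:
# the discharge of `PeriodicNSOrbitPersists` (Iooss 1972; Henry 1981, Thm. 8.3.2; Kielhöfer 2012, §I.8, §I.12)

Analysis/FluidPDE proof file (theorems only; no definitions, no named facts): the assembly of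
the space–time Fourier-lattice proof of `Literature.Analysis.FluidPDE.PeriodicNSOrbitPersists` from

* the lattice estimates (`TimePeriodicNSLattice`), the state space `W ⊂ ℓ²(ℤ × ℤ³; ℂ³)`, its
  multipliers, the bounded bilinear map `B = Π N(·/Λ, ·/Λ)` and the bordered inverse-function
  argument `bordered_local_solve` (`TimePeriodicNSLatticeSpaces`),
* compactness of the linearised convection `K = B(x₀, ·) + B(·, x₀)` (`TimePeriodicNSLatticeCompact`),
* parabolic regularity of lattice solutions (`TimePeriodicNSLatticeRegularity`),
* the dictionary between classical `τ`-periodic solutions and lattice solutions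
  (`TimePeriodicNSLatticeOrbit`, `TimePeriodicNSLatticeRealize`, `TimePeriodicNSLatticeSynthesis`).

Architecture (Iooss 1972, §2–3, in Fourier coordinates; Henry 1981, §8.3; Kielhöfer 2012,
(I.8.9)–(I.8.15) and §I.12): the orbit `u` with period `τ` is the lattice solution
`x₀ = Λ û ∈ W` of `G(x, ω) = ω Dₛx + L₀x + B(x,x) = y_f` with `ω₀ = τ⁻¹`; hypotheses (i)
(simple Floquet multiplier `1`, kernel of the linearisation spanned by `∂ₜu`) and (ii)
(`∂ₜu` not in the range) are exactly `ker(J + K) ⊆ ℝ g` and `Dₛx₀ ∉ range(J + K)` for the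
Fredholm linearisation `J + K`; `bordered_local_solve` then solves `G(x, ω) = y_{f'}` for
`‖y_{f'} − y_f‖ = ‖f' − f‖_{L²} ≤ r` with `(x, ω)` close to `(x₀, ω₀)`, regularity makes `x/Λ`
rapidly decaying, the realization theorem turns it into a classical `ω⁻¹`-periodic solution,
and the slice `H¹` bound converts `‖x − x₀‖ < δ₁` into the uniform-in-time `H¹`-closeness of
the conclusion. Degenerate forces (`∫f ≠ 0` or `div f ≠ 0`) admit no admissible `f'` near `f`.

## References

* G. Iooss, *Bifurcation des solutions périodiques de certains problèmes d'évolution*, /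
  Arch. Rational Mech. Anal. 47 (1972) 301–329, §2–3. [Iooss1972]
* D. Henry, *Geometric Theory of Semilinear Parabolic Equations*, LNM 840 (1981), Thm. 8.3.2, Ex. 6. [Henry1981]
* H. Kielhöfer, *Bifurcation Theory*, 2nd ed. (2012), §I.8 (PDF pp. 59–60), §I.12 (pp. 104–105). [Kielhofer2012]
-/

noncomputable section

open scoped BigOperators Topology ENNReal NNReal ComplexConjugate
open Filter Set Function MeasureTheory UnitAddTorus

namespace Literature.Analysis.FluidPDE

namespace TimePeriodicLattice

open Literature.Analysis.FunctionSpaces Literature.Analysis.FunctionSpaces.Torus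
open Literature.Analysis.FunctionSpaces.EuclideanSpace
open Literature.Analysis.FluidPDE.ScalarFourier

-- NOTATION START
/-- Local notation: the parabolic weight `Λ(n, k) = |n| + |k|²`. -/
local notation:max "Λ" m:max => (|((Prod.fst m : ℤ) : ℝ)| + freqNormSq (Prod.snd m))

/-- Local notation: the convective symbol on `ℤ × ℤ³` (as in `TimePeriodicNSLattice`). -/
local notation:max "𝐍[" a ", " b "]" m:max =>
  (WithLp.toLp 2 (fun p : Fin 3 => ∑ j : Fin 3, ∑' m' : ℤ × (Fin 3 → ℤ),
    a m' j * (dsym j (Prod.snd m - Prod.snd m') * b (m - m') p)) : EuclideanSpace ℂ (Fin 3))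

/-- Local notation: division by the weight. -/
local notation:max "𝐜" x:max => (fun mm : ℤ × (Fin 3 → ℤ) =>
  ((((|((Prod.fst mm : ℤ) : ℝ)| + freqNormSq (Prod.snd mm))⁻¹ : ℝ) : ℂ) • x mm))

/-- Local notation: multiplication by the weight. -/
local notation:max "𝐬" x:max => (fun mm : ℤ × (Fin 3 → ℤ) =>
  ((((|((Prod.fst mm : ℤ) : ℝ)| + freqNormSq (Prod.snd mm)) : ℝ) : ℂ) • x mm))

/-- Local notation: the family of coefficients of `x ∈ W ⊂ ℓ²`. -/
local notation:max "𝐰" x:max =>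
  (((x : lp (fun _ : ℤ × (Fin 3 → ℤ) => EuclideanSpace ℂ (Fin 3)) 2)) : ℤ × (Fin 3 → ℤ) → EuclideanSpace ℂ (Fin 3))

/-- Local notation: the extension `K ↦ c (K₀, tail K)` of a lattice family to `ℤ⁴`. -/
local notation:max "𝐄" c:max => (fun K : Fin 4 → ℤ => c ((K 0, Fin.tail K) : ℤ × (Fin 3 → ℤ)))

/-- Local notation: the lattice family `û(n,k) = 𝓕(complexify ∘ (U − m₀))(n,k)`. -/
local notation:max "𝐮[" U ", " m₀ "]" => (fun mm : ℤ × (Fin 3 → ℤ) =>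
  mFourierCoeff (EuclideanSpace.complexify ∘ fun y : UnitAddTorus (Fin 4) => U y - m₀)
    (Fin.cons (Prod.fst mm) (Prod.snd mm) : Fin 4 → ℤ))

/-- Local notation: the force family `y_F(n,k) = [k ≠ 0][n = 0] 𝓕(complexify ∘ F)(k)`. -/
local notation:max "𝐲" F:max => (fun mm : ℤ × (Fin 3 → ℤ) =>
  (ite (Prod.snd mm = 0) (0 : EuclideanSpace ℂ (Fin 3))
    (ite (Prod.fst mm = 0) (mFourierCoeff (EuclideanSpace.complexify ∘ F) (Prod.snd mm)) 0)))
-- NOTATION END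

variable {W : Submodule ℝ (lp (fun _ : ℤ × (Fin 3 → ℤ) => EuclideanSpace ℂ (Fin 3)) 2)}

/-! ## §A⁷ Elements of `W` from lattice families -/

section Families

/-- `(Λ x)/Λ = x` for families vanishing on the zero spatial modes. [folklore] -/
theorem cw_sw {x : ℤ × (Fin 3 → ℤ) → EuclideanSpace ℂ (Fin 3)} (hx : ∀ n : ℤ, x (n, 0) = 0) : 𝐜 (𝐬 x) = x := by
  funext m
  by_cases hm : m.2 = 0
  · have : x m = 0 := by
      have := hx m.1; rwa [show ((m.1, 0) : ℤ × (Fin 3 → ℤ)) = m from Prod.ext rfl hm.symm] at this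
    simp only [this, smul_zero]
  · have hL : (Λ m) ≠ 0 := ne_of_gt (lt_of_lt_of_le one_pos (one_le_wt hm))
    simp only [smul_smul]
    rw [← Complex.ofReal_mul, inv_mul_cancel₀ hL, Complex.ofReal_one, one_smul]

/-- `Λ (x/Λ) = x` for families vanishing on the zero spatial modes. [folklore] -/
theorem sw_cw {x : ℤ × (Fin 3 → ℤ) → EuclideanSpace ℂ (Fin 3)} (hx : ∀ n : ℤ, x (n, 0) = 0) : 𝐬 (𝐜 x) = x := by
  funext m
  by_cases hm : m.2 = 0
  · have : x m = 0 := by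
      have := hx m.1; rwa [show ((m.1, 0) : ℤ × (Fin 3 → ℤ)) = m from Prod.ext rfl hm.symm] at this
    simp only [this, smul_zero]
  · have hL : (Λ m) ≠ 0 := ne_of_gt (lt_of_lt_of_le one_pos (one_le_wt hm))
    simp only [smul_smul]
    rw [← Complex.ofReal_mul, mul_inv_cancel₀ hL, Complex.ofReal_one, one_smul]

/-- `Λ x` vanishes on the zero spatial modes when `x` does. [folklore] -/
theorem sw_zero_mode {x : ℤ × (Fin 3 → ℤ) → EuclideanSpace ℂ (Fin 3)} (hx : ∀ n : ℤ, x (n, 0) = 0) (n : ℤ) :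
    (𝐬 x) (n, 0) = 0 := by
  simp only [hx n, smul_zero]

/-- `Λ x` is transversal when `x` is. [folklore] -/
theorem sw_transversal {x : ℤ × (Fin 3 → ℤ) → EuclideanSpace ℂ (Fin 3)}
    (hx : ∀ mm : ℤ × (Fin 3 → ℤ), (∑ jj : Fin 3, ((mm.2 jj : ℤ) : ℂ) * (x mm) jj) = 0) (m : ℤ × (Fin 3 → ℤ)) :
    (∑ jj : Fin 3, ((m.2 jj : ℤ) : ℂ) * ((𝐬 x) m) jj) = 0 := by
  change (∑ jj : Fin 3, ((m.2 jj : ℤ) : ℂ) * ((((Λ m) : ℝ) : ℂ) • x m) jj) = 0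
  rw [SteadyLattice.kdot_smul, hx m, mul_zero]

/-- `Λ x` is conjugate symmetric when `x` is. [folklore] -/
theorem sw_neg {x : ℤ × (Fin 3 → ℤ) → EuclideanSpace ℂ (Fin 3)} (hx : ∀ mm, x (-mm) = conjVec (x mm)) (m : ℤ × (Fin 3 → ℤ)) :
    (𝐬 x) (-m) = conjVec ((𝐬 x) m) := by
  change (((Λ (-m)) : ℝ) : ℂ) • x (-m) = conjVec ((((Λ m) : ℝ) : ℂ) • x m)
  rw [wt_neg, hx, conjVec_smul, Complex.conj_ofReal]

/-- `(2πi n) x` vanishes on the zero spatial modes when `x` does. [folklore] -/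
theorem nsmul_zero_mode {x : ℤ × (Fin 3 → ℤ) → EuclideanSpace ℂ (Fin 3)} (hx : ∀ n : ℤ, x (n, 0) = 0) (n : ℤ) :
    (fun mm : ℤ × (Fin 3 → ℤ) => (2 * Real.pi * Complex.I * (mm.1 : ℂ)) • x mm) (n, 0) = 0 := by
  simp only [hx n, smul_zero]

/-- `(2πi n) x` is transversal when `x` is. [folklore] -/
theorem nsmul_transversal {x : ℤ × (Fin 3 → ℤ) → EuclideanSpace ℂ (Fin 3)}
    (hx : ∀ mm : ℤ × (Fin 3 → ℤ), (∑ jj : Fin 3, ((mm.2 jj : ℤ) : ℂ) * (x mm) jj) = 0) (m : ℤ × (Fin 3 → ℤ)) :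
    (∑ jj : Fin 3, ((m.2 jj : ℤ) : ℂ) *
      ((fun mm : ℤ × (Fin 3 → ℤ) => (2 * Real.pi * Complex.I * (mm.1 : ℂ)) • x mm) m) jj) = 0 := by
  change (∑ jj : Fin 3, ((m.2 jj : ℤ) : ℂ) * ((2 * Real.pi * Complex.I * (m.1 : ℂ)) • x m) jj) = 0
  rw [SteadyLattice.kdot_smul, hx m, mul_zero]

/-- `(2πi n) x` is conjugate symmetric when `x` is. [folklore] -/
theorem nsmul_neg {x : ℤ × (Fin 3 → ℤ) → EuclideanSpace ℂ (Fin 3)} (hx : ∀ mm, x (-mm) = conjVec (x mm)) (m : ℤ × (Fin 3 → ℤ)) :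
    (fun mm : ℤ × (Fin 3 → ℤ) => (2 * Real.pi * Complex.I * (mm.1 : ℂ)) • x mm) (-m) =
      conjVec ((fun mm : ℤ × (Fin 3 → ℤ) => (2 * Real.pi * Complex.I * (mm.1 : ℂ)) • x mm) m) := by
  simp only [Prod.fst_neg, Int.cast_neg, hx m, conjVec_smul, map_mul, map_ofNat, Complex.conj_ofReal, Complex.conj_I,
    map_intCast]
  congr 1
  ring

/-- Moments of `(2πi n) x` are bounded by the next-but-one moments of `x`. [folklore] -/
theorem tsum_enorm_nsmul_sq_le (x : ℤ × (Fin 3 → ℤ) → EuclideanSpace ℂ (Fin 3)) (N : ℕ) :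
    ∑' m : ℤ × (Fin 3 → ℤ), ENNReal.ofReal ((Λ m) ^ N) *
        ‖(fun mm : ℤ × (Fin 3 → ℤ) => (2 * Real.pi * Complex.I * (mm.1 : ℂ)) • x mm) m‖ₑ ^ 2 ≤
      ENNReal.ofReal ((2 * Real.pi) ^ 2) * ∑' m : ℤ × (Fin 3 → ℤ), ENNReal.ofReal ((Λ m) ^ (N + 2)) * ‖x m‖ₑ ^ 2 := by
  rw [← ENNReal.tsum_mul_left]
  refine ENNReal.tsum_le_tsum fun m => ?_
  have hw := wt_nonneg m
  have hn : ‖(2 * Real.pi * Complex.I * (m.1 : ℂ) : ℂ)‖ ≤ 2 * Real.pi * Λ m := by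
    rw [norm_mul, Complex.norm_intCast]
    have : ‖(2 * Real.pi * Complex.I : ℂ)‖ = 2 * Real.pi := by simp [abs_of_pos Real.pi_pos]
    rw [this]
    gcongr
    change |((m.1 : ℤ) : ℝ)| ≤ |((m.1 : ℤ) : ℝ)| + freqNormSq m.2
    linarith [freqNormSq_nonneg m.2]
  simp only [enorm_smul]
  calc ENNReal.ofReal ((Λ m) ^ N) * (‖(2 * Real.pi * Complex.I * (m.1 : ℂ) : ℂ)‖ₑ * ‖x m‖ₑ) ^ 2
      ≤ ENNReal.ofReal ((Λ m) ^ N) * (ENNReal.ofReal (2 * Real.pi * Λ m) * ‖x m‖ₑ) ^ 2 := by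
        gcongr; rw [← ofReal_norm]; exact ENNReal.ofReal_le_ofReal hn
    _ = ENNReal.ofReal ((2 * Real.pi) ^ 2) * (ENNReal.ofReal ((Λ m) ^ (N + 2)) * ‖x m‖ₑ ^ 2) := by
        rw [mul_pow, ← ENNReal.ofReal_pow (by positivity), mul_pow, ENNReal.ofReal_mul (by positivity), pow_add,
          ENNReal.ofReal_mul (pow_nonneg hw N)]
        ring

/-- The square sum of a family is bounded by its second... zeroth moment (bookkeeping). [folklore] -/
theorem tsum_enorm_sq_le_moment (x : ℤ × (Fin 3 → ℤ) → EuclideanSpace ℂ (Fin 3)) (hx : ∀ n : ℤ, x (n, 0) = 0) (N : ℕ) :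
    ∑' m : ℤ × (Fin 3 → ℤ), ‖x m‖ₑ ^ 2 ≤ ∑' m : ℤ × (Fin 3 → ℤ), ENNReal.ofReal ((Λ m) ^ N) * ‖x m‖ₑ ^ 2 := by
  refine ENNReal.tsum_le_tsum fun m => ?_
  by_cases hm : m.2 = 0
  · have : x m = 0 := by
      have := hx m.1; rwa [show ((m.1, 0) : ℤ × (Fin 3 → ℤ)) = m from Prod.ext rfl hm.symm] at this
    simp [this]
  · have h1 : (1 : ℝ≥0∞) ≤ ENNReal.ofReal ((Λ m) ^ N) := by
      rw [← ENNReal.ofReal_one]; exact ENNReal.ofReal_le_ofReal (one_le_pow₀ (one_le_wt hm))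
    calc ‖x m‖ₑ ^ 2 = 1 * ‖x m‖ₑ ^ 2 := (one_mul _).symm
      _ ≤ ENNReal.ofReal ((Λ m) ^ N) * ‖x m‖ₑ ^ 2 := by gcongr

variable (hW : ∀ x : lp (fun _ : ℤ × (Fin 3 → ℤ) => EuclideanSpace ℂ (Fin 3)) 2, x ∈ W ↔
      (∀ n : ℤ, (x : ℤ × (Fin 3 → ℤ) → EuclideanSpace ℂ (Fin 3)) (n, 0) = 0) ∧
      (∀ mm : ℤ × (Fin 3 → ℤ), (∑ jj : Fin 3, ((mm.2 jj : ℤ) : ℂ) *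
        ((x : ℤ × (Fin 3 → ℤ) → EuclideanSpace ℂ (Fin 3)) mm) jj) = 0) ∧
      (∀ mm : ℤ × (Fin 3 → ℤ), (x : ℤ × (Fin 3 → ℤ) → EuclideanSpace ℂ (Fin 3)) (-mm) =
        conjVec ((x : ℤ × (Fin 3 → ℤ) → EuclideanSpace ℂ (Fin 3)) mm)))
include hW

/-- **Elements of `W` from admissible square-summable families.** [folklore] -/
theorem exists_memW {v : ℤ × (Fin 3 → ℤ) → EuclideanSpace ℂ (Fin 3)} (hv2 : ∑' m, ‖v m‖ₑ ^ 2 ≠ ⊤)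
    (h0 : ∀ n : ℤ, v (n, 0) = 0)
    (ht : ∀ mm : ℤ × (Fin 3 → ℤ), (∑ jj : Fin 3, ((mm.2 jj : ℤ) : ℂ) * (v mm) jj) = 0)
    (hc : ∀ mm, v (-mm) = conjVec (v mm)) : ∃ X : W, 𝐰 X = v :=
  ⟨⟨⟨v, memℓp_two_of_tsum_ne_top hv2⟩, (hW _).2 ⟨h0, ht, hc⟩⟩, rfl⟩

end Families

/-! ## §B⁷ The force family -/

section Force

variable {F : UnitAddTorus (Fin 3) → EuclideanSpace ℝ (Fin 3)}

/-- The force family vanishes on the zero spatial modes. [folklore] -/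
theorem yf_zero_mode (F : UnitAddTorus (Fin 3) → EuclideanSpace ℝ (Fin 3)) (n : ℤ) : (𝐲 F) (n, 0) = 0 := by
  simp

/-- The force family vanishes off `n = 0`. [folklore] -/
theorem yf_of_fst_ne_zero (F : UnitAddTorus (Fin 3) → EuclideanSpace ℝ (Fin 3)) {m : ℤ × (Fin 3 → ℤ)} (hm : m.1 ≠ 0) :
    (𝐲 F) m = 0 := by
  simp [hm]

/-- The force family off the zero spatial modes. [folklore] -/
theorem yf_of_snd_ne_zero (F : UnitAddTorus (Fin 3) → EuclideanSpace ℝ (Fin 3)) {m : ℤ × (Fin 3 → ℤ)} (hm : m.2 ≠ 0) :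
    (𝐲 F) m = if m.1 = 0 then mFourierCoeff (complexify ∘ F) m.2 else 0 := by
  simp [hm]

/-- The force family is transversal for divergence-free smooth `F`. [folklore] -/
theorem yf_transversal (hF : IsSmooth F) (hFd : IsDivFree F) (m : ℤ × (Fin 3 → ℤ)) :
    (∑ jj : Fin 3, ((m.2 jj : ℤ) : ℂ) * ((𝐲 F) m) jj) = 0 := by
  by_cases hm : m.2 = 0
  · simp [hm]
  · by_cases hn : m.1 = 0
    · simp only [hm, hn, if_false, if_true]
      exact hFd.sum_mul_mFourierCoeff_eq_zero hF m.2
    · simp [hm, hn]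

/-- The force family is conjugate symmetric for real continuous `F`. [folklore] -/
theorem yf_neg (hF : Continuous F) (m : ℤ × (Fin 3 → ℤ)) : (𝐲 F) (-m) = conjVec ((𝐲 F) m) := by
  by_cases hm : m.2 = 0
  · simp [hm, conjVec_zero]
  · have hm' : (-m).2 ≠ 0 := by rw [Prod.snd_neg]; exact neg_ne_zero.2 hm
    rw [yf_of_snd_ne_zero F hm, yf_of_snd_ne_zero F hm']
    simp only [Prod.fst_neg, Prod.snd_neg, neg_eq_zero]
    split_ifs
    · exact conjVec_mFourierCoeff_complexify hF.integrable_unitAddTorus m.2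
    · exact conjVec_zero.symm

/-- **Moments of the force family**: `∑ Λ^N ‖y_F‖² < ∞` for smooth `F` (rapid decay of `F̂`). [folklore] -/
theorem tsum_moment_yf_ne_top (hF : IsSmooth F) (N : ℕ) :
    ∑' m : ℤ × (Fin 3 → ℤ), ENNReal.ofReal ((Λ m) ^ N) * ‖(𝐲 F) m‖ₑ ^ 2 ≠ ⊤ := by
  have hFc : IsSmooth (complexify ∘ F) := hF.comp_clm complexify.toContinuousLinearMap
  have hr := hFc.rapidDecay_mFourierCoeff
  set C := mFourierCoeff (complexify ∘ F) with hC
  -- reduce to the slice `n = 0`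
  set G : ℤ × (Fin 3 → ℤ) → ℝ≥0∞ := fun m => ENNReal.ofReal ((Λ m) ^ N) * ‖(𝐲 F) m‖ₑ ^ 2 with hG
  have hinj : Function.Injective (fun k : Fin 3 → ℤ => ((0 : ℤ), k)) := fun k k' h => by simpa using h
  have hsupp : Function.support G ⊆ Set.range (fun k : Fin 3 → ℤ => ((0 : ℤ), k)) := by
    intro m hm
    by_cases hn : m.1 = 0
    · exact ⟨m.2, Prod.ext hn.symm rfl⟩
    · exact absurd (by simp [hG, yf_of_fst_ne_zero F hn]) hm
  rw [← hinj.tsum_eq hsupp]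
  -- bound on the slice
  set T₀ : ℝ := ∑' k : Fin 3 → ℤ, ‖C k‖ with hT₀
  have hle0 : ∀ k, ‖C k‖ ≤ T₀ := fun k => hr.summable_norm.le_tsum k fun k' _ => norm_nonneg _
  have hT₀0 : 0 ≤ T₀ := (norm_nonneg _).trans (hle0 0)
  have hpt : ∀ k : Fin 3 → ℤ, G ((0 : ℤ), k) ≤ ENNReal.ofReal T₀ * ENNReal.ofReal ((1 + freqNormSq k) ^ N * ‖C k‖) := by
    intro k
    simp only [hG]
    by_cases hk : k = 0
    · simp [hk]
    · rw [if_neg hk, if_pos trivial]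
      rw [← ENNReal.ofReal_mul hT₀0, ← ofReal_norm, ← ENNReal.ofReal_pow (norm_nonneg _),
        ← ENNReal.ofReal_mul (pow_nonneg (add_nonneg (abs_nonneg _) (freqNormSq_nonneg k)) N)]
      refine ENNReal.ofReal_le_ofReal ?_
      have h1 : (Λ ((0 : ℤ), k)) ^ N ≤ (1 + freqNormSq k) ^ N := by
        apply pow_le_pow_left₀ (wt_nonneg _)
        change |((0 : ℤ) : ℝ)| + freqNormSq k ≤ 1 + freqNormSq k
        simp
      calc (Λ ((0 : ℤ), k)) ^ N * ‖C k‖ ^ 2 = ((Λ ((0 : ℤ), k)) ^ N * ‖C k‖) * ‖C k‖ := by ring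
        _ ≤ ((1 + freqNormSq k) ^ N * ‖C k‖) * T₀ :=
            mul_le_mul (mul_le_mul_of_nonneg_right h1 (norm_nonneg _)) (hle0 k) (norm_nonneg _)
              (mul_nonneg (one_add_freqNormSq_pow_nonneg k N) (norm_nonneg _))
        _ = T₀ * ((1 + freqNormSq k) ^ N * ‖C k‖) := by ring
  refine ne_top_of_le_ne_top ?_ (ENNReal.tsum_le_tsum hpt)
  rw [ENNReal.tsum_mul_left, ← ENNReal.ofReal_tsum_of_nonneg (fun k => mul_nonneg (one_add_freqNormSq_pow_nonneg k _)
    (norm_nonneg _)) (hr N)]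
  exact ENNReal.mul_ne_top ENNReal.ofReal_ne_top ENNReal.ofReal_ne_top

/-- **`L²` control of the force family**: `∑ ‖y_G‖² ≤ ∫ ‖G‖²` (Parseval), for continuous `G`. [folklore] -/
theorem tsum_enorm_yf_sq_le {G : UnitAddTorus (Fin 3) → EuclideanSpace ℝ (Fin 3)} (hG : Continuous G) :
    ∑' m : ℤ × (Fin 3 → ℤ), ‖(𝐲 G) m‖ₑ ^ 2 ≤ ENNReal.ofReal (∫ x, ‖G x‖ ^ 2) := by
  have hGc : Continuous (complexify ∘ G) := continuous_complexify.comp hG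
  have hpar := tsum_enorm_sq_mFourierCoeff_euclidean hGc
  have hnorm : (∫ x, ‖(complexify ∘ G) x‖ ^ 2) = ∫ x, ‖G x‖ ^ 2 := by
    congr 1; funext x; simp
  rw [hnorm] at hpar
  rw [← hpar]
  set H : ℤ × (Fin 3 → ℤ) → ℝ≥0∞ := fun m => ‖(𝐲 G) m‖ₑ ^ 2 with hH
  have hinj : Function.Injective (fun k : Fin 3 → ℤ => ((0 : ℤ), k)) := fun k k' h => by simpa using h
  have hsupp : Function.support H ⊆ Set.range (fun k : Fin 3 → ℤ => ((0 : ℤ), k)) := by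
    intro m hm
    by_cases hn : m.1 = 0
    · exact ⟨m.2, Prod.ext hn.symm rfl⟩
    · exact absurd (by simp [hH, yf_of_fst_ne_zero G hn]) hm
  rw [← hinj.tsum_eq hsupp]
  refine ENNReal.tsum_le_tsum fun k => ?_
  simp only [hH]
  by_cases hk : k = 0
  · simp [hk]
  · rw [if_neg hk, if_pos trivial]

/-- The force family is additive in the force (for integrable forces). [folklore] -/
theorem yf_sub {G₁ G₂ : UnitAddTorus (Fin 3) → EuclideanSpace ℝ (Fin 3)} (h₁ : Continuous G₁) (h₂ : Continuous G₂)
    (m : ℤ × (Fin 3 → ℤ)) : (𝐲 G₁) m - (𝐲 G₂) m = (𝐲 (fun x => G₁ x - G₂ x)) m := by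
  by_cases hm : m.2 = 0
  · simp [hm]
  · simp only [hm, if_false]
    split_ifs
    · have e : (complexify ∘ fun x => G₁ x - G₂ x) = (complexify ∘ G₁) - (complexify ∘ G₂) := by
        funext x; simp
      rw [e, mFourierCoeff_sub (continuous_complexify.comp h₁).integrable_unitAddTorus
        (continuous_complexify.comp h₂).integrable_unitAddTorus]
    · simp

end Force

/-! ## §C⁷ The multipliers `Dₛ = 2πi n/Λ`, `L₀ = (4π²ν|k|² + 2πi m₀·k)/Λ` and the symbol -/

section Multipliers

variable {ν : ℝ} {m₀ : EuclideanSpace ℝ (Fin 3)}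

/-- Local notation: the time multiplier `dₛ(n,k) = 2πi n / Λ(n,k)`. -/
local notation "dS" => (fun mm : ℤ × (Fin 3 → ℤ) =>
  (2 * Real.pi * Complex.I * ((Prod.fst mm : ℤ) : ℂ)) * ((((|((Prod.fst mm : ℤ) : ℝ)| + freqNormSq (Prod.snd mm)) : ℝ) : ℂ))⁻¹)

/-- Local notation: the Stokes–drift multiplier `(4π²ν|k|² + 2πi m₀·k) / Λ(n,k)`. -/
local notation "dL[" ν ", " m₀ "]" => (fun mm : ℤ × (Fin 3 → ℤ) =>
  (((4 * Real.pi ^ 2 * ν * freqNormSq (Prod.snd mm) : ℝ) : ℂ) +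
      2 * Real.pi * Complex.I * (∑ jj : Fin 3, ((m₀ jj : ℝ) : ℂ) * (((Prod.snd mm) jj : ℤ) : ℂ))) *
    ((((|((Prod.fst mm : ℤ) : ℝ)| + freqNormSq (Prod.snd mm)) : ℝ) : ℂ))⁻¹)

/-- Local notation: the symbol `σ_om(n,k) = 2πiomn + 4π²ν|k|² + 2πi m₀·k`. -/
local notation "σ[" om ", " ν ", " m₀ "]" => (fun mm : ℤ × (Fin 3 → ℤ) =>
  2 * Real.pi * Complex.I * ((om : ℝ) : ℂ) * ((Prod.fst mm : ℤ) : ℂ) +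
    (((4 * Real.pi ^ 2 * ν * freqNormSq (Prod.snd mm) : ℝ)) : ℂ) +
    2 * Real.pi * Complex.I * (∑ jj : Fin 3, ((m₀ jj : ℝ) : ℂ) * (((Prod.snd mm) jj : ℤ) : ℂ)))

/-- Local notation: the lattice family of the orbit `u` with period `τ`. -/
local notation:max "𝐨[" τ ", " u "]" => (fun mm : ℤ × (Fin 3 → ℤ) =>
  mFourierCoeff (EuclideanSpace.complexify ∘ fun y : UnitAddTorus (Fin 4) => Torus.timeRoll τ u y - ∫ x, u 0 x)
    (Fin.cons (Prod.fst mm) (Prod.snd mm) : Fin 4 → ℤ))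

/-- `|2πi n/Λ| ≤ 2π`. [folklore] -/
theorem norm_dS_le (m : ℤ × (Fin 3 → ℤ)) : ‖dS m‖ ≤ 2 * Real.pi := by
  simp only
  by_cases hL : (Λ m) = 0
  · rw [hL, Complex.ofReal_zero, inv_zero, mul_zero, norm_zero]; positivity
  · have hLp : 0 < Λ m := lt_of_le_of_ne (wt_nonneg m) (Ne.symm hL)
    rw [norm_mul, norm_inv, Complex.norm_real, Real.norm_of_nonneg hLp.le, norm_mul, Complex.norm_intCast]
    have : ‖(2 * Real.pi * Complex.I : ℂ)‖ = 2 * Real.pi := by simp [abs_of_pos Real.pi_pos]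
    rw [this, mul_inv_le_iff₀ hLp]
    gcongr
    change |((m.1 : ℤ) : ℝ)| ≤ |((m.1 : ℤ) : ℝ)| + freqNormSq m.2
    linarith [freqNormSq_nonneg m.2]

/-- The drift scalar is bounded by the weight: `|m₀ · k| ≤ 6‖m₀‖ Λ(n,k)`. [folklore] -/
theorem norm_drift_le (m₀ : EuclideanSpace ℝ (Fin 3)) (m : ℤ × (Fin 3 → ℤ)) :
    ‖(∑ jj : Fin 3, ((m₀ jj : ℝ) : ℂ) * ((m.2 jj : ℤ) : ℂ))‖ ≤ 6 * ‖m₀‖ * Λ m := by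
  by_cases hk : m.2 = 0
  · simp [hk]; positivity
  · have h1 : (∑ jj : Fin 3, ((m₀ jj : ℝ) : ℂ) * ((m.2 jj : ℤ) : ℂ)) =
        ∑ jj : Fin 3, ((m.2 jj : ℤ) : ℂ) * (complexify m₀) jj := by
      refine Finset.sum_congr rfl fun jj _ => ?_; rw [complexify_apply, mul_comm]
    rw [h1]
    refine (SteadyLattice.norm_kdot_le m.2 (complexify m₀)).trans ?_
    rw [norm_complexify]
    have hb : 1 ≤ freqNormSq m.2 := Torus.one_le_freqNormSq hk
    have hsw : sobolevWeight 1 m.2 ≤ 2 * Λ m := by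
      rw [sobolevWeight]
      calc (1 + freqNormSq m.2) ^ ((1 : ℝ) / 2) ≤ (1 + freqNormSq m.2) ^ (1 : ℝ) :=
            Real.rpow_le_rpow_of_exponent_le (by linarith) (by norm_num)
        _ = 1 + freqNormSq m.2 := Real.rpow_one _
        _ ≤ 2 * Λ m := by linarith [abs_nonneg ((m.1 : ℤ) : ℝ)]
    calc 3 * sobolevWeight 1 m.2 * ‖m₀‖ ≤ 3 * (2 * Λ m) * ‖m₀‖ := by gcongr
      _ = 6 * ‖m₀‖ * Λ m := by ring

/-- `|(4π²ν|k|² + 2πi m₀·k)/Λ| ≤ 4π²|ν| + 12π‖m₀‖`. [folklore] -/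
theorem norm_dL_le (m : ℤ × (Fin 3 → ℤ)) : ‖dL[ν, m₀] m‖ ≤ 4 * Real.pi ^ 2 * |ν| + 12 * Real.pi * ‖m₀‖ := by
  simp only
  by_cases hL : (Λ m) = 0
  · rw [hL, Complex.ofReal_zero, inv_zero, mul_zero, norm_zero]; positivity
  · have hLp : 0 < Λ m := lt_of_le_of_ne (wt_nonneg m) (Ne.symm hL)
    rw [norm_mul, norm_inv, Complex.norm_real, Real.norm_of_nonneg hLp.le, mul_inv_le_iff₀ hLp]
    refine (norm_add_le _ _).trans ?_
    have h1 : ‖(((4 * Real.pi ^ 2 * ν * freqNormSq m.2 : ℝ)) : ℂ)‖ ≤ 4 * Real.pi ^ 2 * |ν| * Λ m := by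
      rw [Complex.norm_real, Real.norm_eq_abs, abs_mul, abs_of_nonneg (freqNormSq_nonneg _),
        abs_mul, abs_of_nonneg (by positivity : (0 : ℝ) ≤ 4 * Real.pi ^ 2)]
      gcongr
      change freqNormSq m.2 ≤ |((m.1 : ℤ) : ℝ)| + freqNormSq m.2
      linarith [abs_nonneg ((m.1 : ℤ) : ℝ)]
    have h2 : ‖2 * Real.pi * Complex.I * (∑ jj : Fin 3, ((m₀ jj : ℝ) : ℂ) * ((m.2 jj : ℤ) : ℂ))‖ ≤
        12 * Real.pi * ‖m₀‖ * Λ m := by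
      rw [norm_mul]
      have : ‖(2 * Real.pi * Complex.I : ℂ)‖ = 2 * Real.pi := by simp [abs_of_pos Real.pi_pos]
      rw [this]
      calc 2 * Real.pi * ‖(∑ jj : Fin 3, ((m₀ jj : ℝ) : ℂ) * ((m.2 jj : ℤ) : ℂ))‖
          ≤ 2 * Real.pi * (6 * ‖m₀‖ * Λ m) := by gcongr; exact norm_drift_le m₀ m
        _ = 12 * Real.pi * ‖m₀‖ * Λ m := by ring
    calc _ ≤ 4 * Real.pi ^ 2 * |ν| * Λ m + 12 * Real.pi * ‖m₀‖ * Λ m := add_le_add h1 h2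
      _ = (4 * Real.pi ^ 2 * |ν| + 12 * Real.pi * ‖m₀‖) * Λ m := by ring

/-- `dₛ(−m) = conj dₛ(m)`. [folklore] -/
theorem dS_neg (m : ℤ × (Fin 3 → ℤ)) : dS (-m) = conj (dS m) := by
  simp only [wt_neg]
  simp only [Prod.fst_neg, Int.cast_neg, map_mul, map_ofNat, Complex.conj_ofReal, Complex.conj_I, map_intCast,
    map_inv₀]
  ring

/-- `dL(−m) = conj dL(m)`. [folklore] -/
theorem dL_neg (m : ℤ × (Fin 3 → ℤ)) : dL[ν, m₀] (-m) = conj (dL[ν, m₀] m) := by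
  simp only [wt_neg]
  simp only [Prod.snd_neg, Pi.neg_apply, Int.cast_neg, map_mul, map_add, map_ofNat, Complex.conj_ofReal,
    Complex.conj_I, map_intCast, map_inv₀, map_sum, freqNormSq_neg, mul_neg, Finset.sum_neg_distrib]
  ring

/-- **The symbol in terms of the multipliers**: `om dₛ(m) + dL(m) = σ_om(m) Λ(m)⁻¹`. [folklore] -/
theorem omega_dS_add_dL (om : ℝ) (m : ℤ × (Fin 3 → ℤ)) :
    (om : ℂ) * dS m + dL[ν, m₀] m = σ[om, ν, m₀] m * ((((Λ m) : ℝ)) : ℂ)⁻¹ := by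
  simp only
  ring

/-- The symbol multiplier is conjugate symmetric. [folklore] -/
theorem omega_dS_add_dL_neg (om : ℝ) (m : ℤ × (Fin 3 → ℤ)) :
    (fun mm => (om : ℂ) * dS mm + dL[ν, m₀] mm) (-m) = conj ((fun mm => (om : ℂ) * dS mm + dL[ν, m₀] mm) m) := by
  show (om : ℂ) * dS (-m) + dL[ν, m₀] (-m) = conj ((om : ℂ) * dS m + dL[ν, m₀] m)
  rw [map_add, map_mul, Complex.conj_ofReal, ← dS_neg, ← dL_neg]

/-- The symbol multiplier is bounded. [folklore] -/
theorem norm_omega_dS_add_dL_le (om : ℝ) (m : ℤ × (Fin 3 → ℤ)) :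
    ‖(fun mm => (om : ℂ) * dS mm + dL[ν, m₀] mm) m‖ ≤ |om| * (2 * Real.pi) + (4 * Real.pi ^ 2 * |ν| + 12 * Real.pi * ‖m₀‖) := by
  show ‖(om : ℂ) * dS m + dL[ν, m₀] m‖ ≤ _
  refine (norm_add_le _ _).trans (add_le_add ?_ (norm_dL_le m))
  rw [norm_mul, Complex.norm_real, Real.norm_eq_abs]
  exact mul_le_mul_of_nonneg_left (norm_dS_le m) (abs_nonneg _)

/-- The symbol multiplier is bounded below off the zero spatial modes when the symbol is:
`c Λ ≤ ‖σ(m)‖` gives `c ≤ ‖σ(m)/Λ‖`. [folklore] -/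
theorem le_norm_omega_dS_add_dL {om c : ℝ} (hcl : ∀ m : ℤ × (Fin 3 → ℤ), m.2 ≠ 0 → c * Λ m ≤ ‖σ[om, ν, m₀] m‖)
    (m : ℤ × (Fin 3 → ℤ)) (hm : m.2 ≠ 0) : c ≤ ‖(fun mm => (om : ℂ) * dS mm + dL[ν, m₀] mm) m‖ := by
  show c ≤ ‖(om : ℂ) * dS m + dL[ν, m₀] m‖
  rw [omega_dS_add_dL, norm_mul, norm_inv, Complex.norm_real, Real.norm_of_nonneg (wt_nonneg m)]
  have hL : 0 < Λ m := lt_of_lt_of_le one_pos (one_le_wt hm)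
  rw [le_mul_inv_iff₀ hL]
  exact hcl m hm


/-! ## §D⁷ Coordinates of the lattice map and of its linearisation -/

section Coordinates

variable (hW : ∀ x : lp (fun _ : ℤ × (Fin 3 → ℤ) => EuclideanSpace ℂ (Fin 3)) 2, x ∈ W ↔
      (∀ n : ℤ, (x : ℤ × (Fin 3 → ℤ) → EuclideanSpace ℂ (Fin 3)) (n, 0) = 0) ∧
      (∀ mm : ℤ × (Fin 3 → ℤ), (∑ jj : Fin 3, ((mm.2 jj : ℤ) : ℂ) *
        ((x : ℤ × (Fin 3 → ℤ) → EuclideanSpace ℂ (Fin 3)) mm) jj) = 0) ∧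
      (∀ mm : ℤ × (Fin 3 → ℤ), (x : ℤ × (Fin 3 → ℤ) → EuclideanSpace ℂ (Fin 3)) (-mm) =
        conjVec ((x : ℤ × (Fin 3 → ℤ) → EuclideanSpace ℂ (Fin 3)) mm)))
variable {Ds L₀ : W →L[ℝ] W} (hDs : ∀ (x : W) (m : ℤ × (Fin 3 → ℤ)), (𝐰 (Ds x)) m = dS m • (𝐰 x) m)
  (hL₀ : ∀ (x : W) (m : ℤ × (Fin 3 → ℤ)), (𝐰 (L₀ x)) m = dL[ν, m₀] m • (𝐰 x) m)
variable {B : W → W → W} (hBf : ∀ (x y : W) (m : ℤ × (Fin 3 → ℤ)), (𝐰 (B x y)) m = Torus.lerayCoeff m.2 (𝐍[𝐜 (𝐰 x), 𝐜 (𝐰 y)] m))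

include hDs hL₀ hBf in
/-- **Coordinates of the lattice map** `G(x, ω) = ω Dₛx + L₀x + B(x,x)` off the zero modes:
`G(x,ω)(m) = σ_ω(m) (x/Λ)(m) + Π_k N(x/Λ, x/Λ)(m)`. [folklore] -/
theorem coord_G (x : W) (om : ℝ) (m : ℤ × (Fin 3 → ℤ)) :
    (𝐰 ((om • Ds x + L₀ x + B x x : W))) m = σ[om, ν, m₀] m • (𝐜 (𝐰 x)) m + Torus.lerayCoeff m.2 (𝐍[𝐜 (𝐰 x), 𝐜 (𝐰 x)] m) := by
  rw [coeW_add, coeW_add, coeW_smul, Pi.add_apply, Pi.add_apply, Pi.smul_apply, hDs, hL₀, hBf]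
  congr 1
  rw [← Complex.coe_smul, smul_smul, ← add_smul, omega_dS_add_dL, ← smul_smul, ← Complex.ofReal_inv]

include hDs hL₀ hBf in
/-- **Coordinates of the linearisation** `ω Dₛh + L₀h + B(x₀,h) + B(h,x₀)` off the zero modes. [folklore] -/
theorem coord_lin (h x₀ : W) (om : ℝ) (m : ℤ × (Fin 3 → ℤ)) :
    (𝐰 ((om • Ds h + L₀ h + (B x₀ h + B h x₀) : W))) m = σ[om, ν, m₀] m • (𝐜 (𝐰 h)) m +
      Torus.lerayCoeff m.2 (𝐍[𝐜 (𝐰 x₀), 𝐜 (𝐰 h)] m + 𝐍[𝐜 (𝐰 h), 𝐜 (𝐰 x₀)] m) := by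
  rw [coeW_add, coeW_add, coeW_add, coeW_smul, Pi.add_apply, Pi.add_apply, Pi.add_apply, Pi.smul_apply, hDs, hL₀, hBf,
    hBf, SteadyLattice.lerayCoeff_add']
  congr 1
  rw [← Complex.coe_smul, smul_smul, ← add_smul, omega_dS_add_dL, ← smul_smul, ← Complex.ofReal_inv]

/-- `‖x m‖ ≤ ‖(Λ x) m‖` for families vanishing on the zero spatial modes. [folklore] -/
theorem enorm_le_enorm_sw {x : ℤ × (Fin 3 → ℤ) → EuclideanSpace ℂ (Fin 3)} (hx : ∀ n : ℤ, x (n, 0) = 0) (m : ℤ × (Fin 3 → ℤ)) :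
    ‖x m‖ₑ ≤ ‖(𝐬 x) m‖ₑ := by
  by_cases hm : m.2 = 0
  · have : x m = 0 := by
      have := hx m.1; rwa [show ((m.1, 0) : ℤ × (Fin 3 → ℤ)) = m from Prod.ext rfl hm.symm] at this
    simp [this]
  · have hL : 1 ≤ Λ m := one_le_wt hm
    change ‖x m‖ₑ ≤ ‖((((Λ m)) : ℝ) : ℂ) • x m‖ₑ
    rw [enorm_smul]
    have h1 : (1 : ℝ≥0∞) ≤ ‖((((Λ m)) : ℝ) : ℂ)‖ₑ := by
      rw [← ofReal_norm, Complex.norm_real, Real.norm_of_nonneg (wt_nonneg m), ← ENNReal.ofReal_one]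
      exact ENNReal.ofReal_le_ofReal hL
    calc ‖x m‖ₑ = 1 * ‖x m‖ₑ := (one_mul _).symm
      _ ≤ _ := by gcongr

/-- `‖(Λ x)(m)‖ = Λ(m) ‖x(m)‖`. [folklore] -/
theorem norm_sw_apply (x : ℤ × (Fin 3 → ℤ) → EuclideanSpace ℂ (Fin 3)) (m : ℤ × (Fin 3 → ℤ)) :
    ‖(𝐬 x) m‖ = Λ m * ‖x m‖ := by
  change ‖((((Λ m)) : ℝ) : ℂ) • x m‖ = _
  rw [norm_smul, Complex.norm_real, Real.norm_of_nonneg (wt_nonneg m)]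

end Coordinates

/-! ## §E⁷ The linearisation at the orbit: the kernel and the range conditions -/

section Linearisation

variable {τ : ℝ} {f : UnitAddTorus (Fin 3) → EuclideanSpace ℝ (Fin 3)}
  {u : ℝ → UnitAddTorus (Fin 3) → EuclideanSpace ℝ (Fin 3)} {p : ℝ → UnitAddTorus (Fin 3) → ℝ}

variable (hW : ∀ x : lp (fun _ : ℤ × (Fin 3 → ℤ) => EuclideanSpace ℂ (Fin 3)) 2, x ∈ W ↔
      (∀ n : ℤ, (x : ℤ × (Fin 3 → ℤ) → EuclideanSpace ℂ (Fin 3)) (n, 0) = 0) ∧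
      (∀ mm : ℤ × (Fin 3 → ℤ), (∑ jj : Fin 3, ((mm.2 jj : ℤ) : ℂ) *
        ((x : ℤ × (Fin 3 → ℤ) → EuclideanSpace ℂ (Fin 3)) mm) jj) = 0) ∧
      (∀ mm : ℤ × (Fin 3 → ℤ), (x : ℤ × (Fin 3 → ℤ) → EuclideanSpace ℂ (Fin 3)) (-mm) =
        conjVec ((x : ℤ × (Fin 3 → ℤ) → EuclideanSpace ℂ (Fin 3)) mm)))
variable {Ds L₀ : W →L[ℝ] W} (hDs : ∀ (x : W) (m : ℤ × (Fin 3 → ℤ)), (𝐰 (Ds x)) m = dS m • (𝐰 x) m)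
  (hL₀ : ∀ (x : W) (m : ℤ × (Fin 3 → ℤ)), (𝐰 (L₀ x)) m = dL[ν, ∫ x, u 0 x] m • (𝐰 x) m)
variable {B : W → W → W} (hBf : ∀ (x y : W) (m : ℤ × (Fin 3 → ℤ)), (𝐰 (B x y)) m = Torus.lerayCoeff m.2 (𝐍[𝐜 (𝐰 x), 𝐜 (𝐰 y)] m))

include hW hDs hL₀ hBf in
/-- **The linearised lattice equation and its regularity** (Iooss 1972, §3; Henry 1981, Lemma
8.3.1, on the Fourier side): if `h ∈ W` solves `τ⁻¹ Dₛh + L₀h + B(x₀,h) + B(h,x₀) = Y` at the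
orbit `x₀ = Λû` with `Y(m) = b (2πi n) û(m)`, then `ĥ = h/Λ` solves the linearised projected
lattice equation with right-hand side `b (2πi n) û` and has rapidly decaying extension. [folklore] -/
theorem linear_core (hν : 0 < ν) (hτ : 0 < τ) (hsol : Torus.IsClassicalNSSolutionOn univ ν (fun _ => f) u p)
    (hper : Function.Periodic u τ) (hf0 : HasZeroMean f)
    (x₀ : W) (hx₀ : 𝐰 x₀ = 𝐬 (𝐨[τ, u])) (h Y : W) {b : ℂ}
    (hY : ∀ m, (𝐰 Y) m = b • ((2 * Real.pi * Complex.I * (m.1 : ℂ)) • 𝐨[τ, u] m))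
    (heqW : τ⁻¹ • Ds h + L₀ h + (B x₀ h + B h x₀) = Y) :
    (∀ m : ℤ × (Fin 3 → ℤ), m.2 ≠ 0 →
      (2 * Real.pi * Complex.I * ((τ⁻¹ : ℝ) : ℂ) * (m.1 : ℂ) + ((4 * Real.pi ^ 2 * ν * freqNormSq m.2 : ℝ) : ℂ) +
          2 * Real.pi * Complex.I * (∑ jj : Fin 3, ((((∫ x, u 0 x) : EuclideanSpace ℝ (Fin 3)) jj : ℝ) : ℂ) * ((m.2 jj : ℤ) : ℂ))) •
          (𝐜 (𝐰 h)) m +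
        Torus.lerayCoeff m.2 (𝐍[𝐨[τ, u], 𝐜 (𝐰 h)] m + 𝐍[𝐜 (𝐰 h), 𝐨[τ, u]] m) =
        b • ((2 * Real.pi * Complex.I * (m.1 : ℂ)) • 𝐨[τ, u] m)) ∧
    RapidDecay (𝐄 (𝐜 (𝐰 h))) := by
  have hu0 : ∀ n : ℤ, 𝐨[τ, u] ((n, 0) : ℤ × (Fin 3 → ℤ)) = 0 := orbit_zero_modes hsol hper hf0
  have hcx₀ : 𝐜 (𝐰 x₀) = 𝐨[τ, u] := by rw [hx₀]; exact cw_sw (x := 𝐨[τ, u]) hu0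
  -- the equation
  have heq : ∀ m : ℤ × (Fin 3 → ℤ), m.2 ≠ 0 →
      σ[τ⁻¹, ν, ∫ x, u 0 x] m • (𝐜 (𝐰 h)) m +
        Torus.lerayCoeff m.2 (𝐍[𝐨[τ, u], 𝐜 (𝐰 h)] m + 𝐍[𝐜 (𝐰 h), 𝐨[τ, u]] m) =
        b • ((2 * Real.pi * Complex.I * (m.1 : ℂ)) • 𝐨[τ, u] m) := by
    intro m hm
    have h1 := congrArg (fun z : W => (𝐰 z) m) heqW
    simp only at h1
    rw [coord_lin hDs hL₀ hBf h x₀ τ⁻¹ m, hcx₀, hY] at h1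
    exact h1
  refine ⟨heq, ?_⟩
  -- regularity
  obtain ⟨c, hc, hcl⟩ := exists_symbol_lower_bound (inv_pos.2 hτ) hν (∫ x, u 0 x)
  have hx0 : ∀ n : ℤ, (𝐰 h) (n, 0) = 0 := W_zero hW h
  have hx₀0 : ∀ n : ℤ, (𝐰 x₀) (n, 0) = 0 := W_zero hW x₀
  have hmomx₀ : ∀ N : ℕ, ∑' m, ENNReal.ofReal ((Λ m) ^ N) * ‖(𝐰 x₀) m‖ₑ ^ 2 ≠ ⊤ := by
    intro N; rw [hx₀]
    exact moments_of_rapidDecay (C := mFourierCoeff (complexify ∘ fun y => timeRoll τ u y - ∫ x, u 0 x))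
      (orbit_rapidDecay hsol hper) N
  have hmomy : ∀ N : ℕ, ∑' m, ENNReal.ofReal ((Λ m) ^ N) *
      ‖(fun mm : ℤ × (Fin 3 → ℤ) => b • ((2 * Real.pi * Complex.I * (mm.1 : ℂ)) • 𝐨[τ, u] mm)) m‖ₑ ^ 2 ≠ ⊤ := by
    intro N
    have h1 : ∑' m, ENNReal.ofReal ((Λ m) ^ N) *
        ‖(fun mm : ℤ × (Fin 3 → ℤ) => b • ((2 * Real.pi * Complex.I * (mm.1 : ℂ)) • 𝐨[τ, u] mm)) m‖ₑ ^ 2 =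
        ‖b‖ₑ ^ 2 * ∑' m, ENNReal.ofReal ((Λ m) ^ N) *
          ‖(fun mm : ℤ × (Fin 3 → ℤ) => (2 * Real.pi * Complex.I * (mm.1 : ℂ)) • 𝐨[τ, u] mm) m‖ₑ ^ 2 := by
      rw [← ENNReal.tsum_mul_left]
      refine tsum_congr fun m => ?_
      simp only [enorm_smul]; ring
    rw [h1]
    refine ENNReal.mul_ne_top (ENNReal.pow_ne_top enorm_ne_top) (ne_top_of_le_ne_top ?_ (tsum_enorm_nsmul_sq_le (𝐨[τ, u]) N))
    refine ENNReal.mul_ne_top ENNReal.ofReal_ne_top (ne_top_of_le_ne_top (hmomx₀ (N + 2)) ?_)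
    rw [hx₀]
    exact ENNReal.tsum_le_tsum fun m => by gcongr; exact enorm_le_enorm_sw (x := 𝐨[τ, u]) hu0 m
  have hineq : ∀ m : ℤ × (Fin 3 → ℤ), m.2 ≠ 0 →
      c * ‖(𝐰 h) m‖ ≤ ‖(fun mm : ℤ × (Fin 3 → ℤ) => b • ((2 * Real.pi * Complex.I * (mm.1 : ℂ)) • 𝐨[τ, u] mm)) m‖ +
        ‖𝐍[𝐜 (𝐰 h), 𝐜 (𝐰 h)] m‖ + ‖𝐍[𝐜 (𝐰 x₀), 𝐜 (𝐰 h)] m‖ + ‖𝐍[𝐜 (𝐰 h), 𝐜 (𝐰 x₀)] m‖ := by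
    intro m hm
    have he := heq m hm
    rw [hcx₀]
    have hL : (Λ m) ≠ 0 := ne_of_gt (lt_of_lt_of_le one_pos (one_le_wt hm))
    have hxm : ‖(𝐰 h) m‖ = Λ m * ‖(𝐜 (𝐰 h)) m‖ := by
      have e1 : ‖(𝐜 (𝐰 h)) m‖ = (Λ m)⁻¹ * ‖(𝐰 h) m‖ := by
        change ‖((((Λ m)⁻¹ : ℝ)) : ℂ) • (𝐰 h) m‖ = _
        rw [norm_smul, Complex.norm_real, Real.norm_of_nonneg (inv_nonneg.2 (wt_nonneg m))]
      rw [e1, ← mul_assoc, mul_inv_cancel₀ hL, one_mul]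
    have hσ := hcl m hm
    have h1 : ‖σ[τ⁻¹, ν, ∫ x, u 0 x] m • (𝐜 (𝐰 h)) m‖ ≤
        ‖b • ((2 * Real.pi * Complex.I * (m.1 : ℂ)) • 𝐨[τ, u] m)‖ +
          (‖𝐍[𝐨[τ, u], 𝐜 (𝐰 h)] m‖ + ‖𝐍[𝐜 (𝐰 h), 𝐨[τ, u]] m‖) := by
      rw [show σ[τ⁻¹, ν, ∫ x, u 0 x] m • (𝐜 (𝐰 h)) m = b • ((2 * Real.pi * Complex.I * (m.1 : ℂ)) • 𝐨[τ, u] m) -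
        Torus.lerayCoeff m.2 (𝐍[𝐨[τ, u], 𝐜 (𝐰 h)] m + 𝐍[𝐜 (𝐰 h), 𝐨[τ, u]] m) by rw [← he]; abel]
      refine (norm_sub_le _ _).trans (add_le_add le_rfl ?_)
      exact (SteadyLattice.norm_lerayCoeff_le _ _).trans (norm_add_le _ _)
    rw [norm_smul] at h1
    have h0 : 0 ≤ ‖𝐍[𝐜 (𝐰 h), 𝐜 (𝐰 h)] m‖ := norm_nonneg _
    calc c * ‖(𝐰 h) m‖ = (c * Λ m) * ‖(𝐜 (𝐰 h)) m‖ := by rw [hxm]; ring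
      _ ≤ ‖σ[τ⁻¹, ν, ∫ x, u 0 x] m‖ * ‖(𝐜 (𝐰 h)) m‖ := mul_le_mul_of_nonneg_right hσ (norm_nonneg _)
      _ ≤ _ := by linarith
  have hmom := moments_of_lattice_ineq hc (𝐰 h) (𝐰 x₀) _ hx0 hx₀0 (l2_tsum_enorm_sq_ne_top _) hmomx₀ hmomy hineq
  exact rapidDecay_of_moments hx0 hmom

include hW hDs hL₀ hBf in
/-- **The kernel condition** (Henry 1981, Thm. 8.3.2, hypothesis "1 is a simple multiplier";
Iooss 1972, §3): under hypothesis (i) of `PeriodicNSOrbitPersists`, every solution `h ∈ W` of the linearised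
lattice equation `τ⁻¹ Dₛh + L₀h + B(x₀,h) + B(h,x₀) = 0` is a real multiple of the
time-derivative direction `g = (2πi n) x₀`. [folklore] -/
theorem ker_condition (hν : 0 < ν) (hτ : 0 < τ) (hsol : Torus.IsClassicalNSSolutionOn univ ν (fun _ => f) u p)
    (hper : Function.Periodic u τ) (hf0 : HasZeroMean f)
    (hK : ∀ (w : ℝ → UnitAddTorus (Fin 3) → EuclideanSpace ℂ (Fin 3)) (q : ℝ → UnitAddTorus (Fin 3) → ℂ),
        IsSmoothSpaceTimeOn Set.univ w → IsSmoothSpaceTimeOn Set.univ q →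
        (∀ t, Torus.IsDivFreeC (w t)) → (∀ t, Torus.HasZeroMean (w t)) → Function.Periodic w τ →
        (∀ t x, timeDerivWithin Set.univ w t x = Torus.linearizedNSOperator ν (u t) (w t) (q t) x) →
        ∃ z : ℂ, ∀ t x, w t x = z • Torus.realToComplex (timeDerivWithin Set.univ u t x))
    (x₀ : W) (hx₀ : 𝐰 x₀ = 𝐬 (𝐨[τ, u])) (g : W)
    (hg : 𝐰 g = fun mm : ℤ × (Fin 3 → ℤ) => (2 * Real.pi * Complex.I * (mm.1 : ℂ)) • (𝐬 (𝐨[τ, u])) mm)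
    (h : W) (heqW : τ⁻¹ • Ds h + L₀ h + (B x₀ h + B h x₀) = 0) : ∃ r : ℝ, h = r • g := by
  obtain ⟨heq, hhr⟩ := linear_core hW hDs hL₀ hBf hν hτ hsol hper hf0 x₀ hx₀ h 0 (b := 0)
    (fun m => by rw [coeW_zero, Pi.zero_apply, zero_smul]) heqW
  have hU : IsSmooth (timeRoll τ u) := orbit_isSmooth hsol hper
  have hu0 := orbit_zero_modes hsol hper hf0
  have hut := orbit_transversal hsol hper
  have hh0 : ∀ n : ℤ, (𝐜 (𝐰 h)) (n, 0) = 0 := cw_zero_mode (W_zero hW h)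
  have hht : ∀ mm : ℤ × (Fin 3 → ℤ), (∑ jj : Fin 3, ((mm.2 jj : ℤ) : ℂ) * ((𝐜 (𝐰 h)) mm) jj) = 0 :=
    cw_transversal (W_trans hW h)
  obtain ⟨Q, hQ, hE⟩ := linear_rolledUp_of_coeff (U := timeRoll τ u) (m₀ := ∫ x, u 0 x) (h := 𝐜 (𝐰 h)) (b := 0)
    hU hu0 hut hh0 hht hhr heq
  obtain ⟨hsw, hsq, hdivC, hmeanC, hperw, hEq⟩ := linear_classical (ν := ν) hτ hsol.smooth_velocity hper
    hhr.isSmooth_fourierSynth hQ hE (div_synth_eq_zero (h := 𝐜 (𝐰 h)) hht hhr)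
    (integral_timeSlice_synth_eq_zero (h := 𝐜 (𝐰 h)) hh0 hhr)
  obtain ⟨z, hz⟩ := hK _ _ hsw hsq hdivC hmeanC hperw (fun t x => by rw [hEq t x, zero_mul, zero_smul, add_zero])
  have hcoef := coeff_eq_of_synth_eq_smul_timeDeriv (h := 𝐜 (𝐰 h)) hτ hsol.smooth_velocity hper hhr (∫ x, u 0 x) hz
  -- `𝐰 h = z' • 𝐰 g`
  obtain ⟨z', hz'⟩ : ∃ z' : ℂ, z' = z * ((τ⁻¹ : ℝ) : ℂ) := ⟨_, rfl⟩
  have hx : ∀ m, (𝐰 h) m = z' • (𝐰 g) m := by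
    intro m
    have e1 := congrArg (fun F : ℤ × (Fin 3 → ℤ) → EuclideanSpace ℂ (Fin 3) => F m) (sw_cw (x := 𝐰 h) (W_zero hW h))
    simp only at e1
    rw [← e1, hcoef m, hg, hz']
    simp only [smul_smul]
    congr 1
    ring
  by_cases hg0 : ∀ m, (𝐰 g) m = 0
  · refine ⟨0, W_ext fun m => ?_⟩
    rw [hx m, hg0 m, smul_zero, coeW_smul, Pi.smul_apply, hg0 m, smul_zero]
  · simp only [not_forall] at hg0
    obtain ⟨m, hm⟩ := hg0
    have hreal : conj z' = z' := by
      have h1 := W_conj hW h m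
      rw [hx (-m), hx m, W_conj hW g m, conjVec_smul] at h1
      have h2 : (z' - conj z') • conjVec ((𝐰 g) m) = 0 := by rw [sub_smul, h1, sub_self]
      rcases smul_eq_zero.1 h2 with h3 | h3
      · exact (sub_eq_zero.1 h3).symm
      · have : (𝐰 g) m = 0 := by simpa [conjVec_conjVec, conjVec_zero] using congrArg conjVec h3
        exact absurd this hm
    refine ⟨z'.re, W_ext fun m' => ?_⟩
    rw [hx m', coeW_smul, Pi.smul_apply, ← Complex.coe_smul]
    congr 1
    exact (Complex.conj_eq_iff_re.1 hreal).symm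

include hW hDs hL₀ hBf in
/-- **The range condition** (Henry 1981, Thm. 8.3.2 / Kielhöfer 2012, (I.12.6): transversality
in the period direction): under hypothesis (ii) of `PeriodicNSOrbitPersists`, `Dₛx₀` is not in the range of the
linearisation `τ⁻¹ Dₛ + L₀ + B(x₀,·) + B(·,x₀)`. [folklore] -/
theorem range_condition (hν : 0 < ν) (hτ : 0 < τ) (hsol : Torus.IsClassicalNSSolutionOn univ ν (fun _ => f) u p)
    (hper : Function.Periodic u τ) (hf0 : HasZeroMean f)
    (hR : ∀ (w : ℝ → UnitAddTorus (Fin 3) → EuclideanSpace ℂ (Fin 3)) (q : ℝ → UnitAddTorus (Fin 3) → ℂ),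
        IsSmoothSpaceTimeOn Set.univ w → IsSmoothSpaceTimeOn Set.univ q →
        (∀ t, Torus.IsDivFreeC (w t)) → (∀ t, Torus.HasZeroMean (w t)) → Function.Periodic w τ →
        ∃ t x, timeDerivWithin Set.univ w t x ≠ Torus.linearizedNSOperator ν (u t) (w t) (q t) x +
            Torus.realToComplex (timeDerivWithin Set.univ u t x))
    (x₀ : W) (hx₀ : 𝐰 x₀ = 𝐬 (𝐨[τ, u])) (h : W) (heqW : τ⁻¹ • Ds h + L₀ h + (B x₀ h + B h x₀) = Ds x₀) : False := by
  have hu0 := orbit_zero_modes hsol hper hf0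
  have hY : ∀ m, (𝐰 (Ds x₀)) m = (1 : ℂ) • ((2 * Real.pi * Complex.I * (m.1 : ℂ)) • 𝐨[τ, u] m) := by
    intro m
    rw [hDs, hx₀, one_smul]
    by_cases hm : m.2 = 0
    · have h0 : 𝐨[τ, u] m = 0 := by
        have := hu0 m.1; rwa [show ((m.1, 0) : ℤ × (Fin 3 → ℤ)) = m from Prod.ext rfl hm.symm] at this
      simp only [h0, smul_zero]
    · have hL : ((((Λ m)) : ℝ) : ℂ) ≠ 0 := by
        exact_mod_cast ne_of_gt (lt_of_lt_of_le one_pos (one_le_wt hm))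
      simp only [smul_smul]
      congr 1
      field_simp
  obtain ⟨heq, hhr⟩ := linear_core hW hDs hL₀ hBf hν hτ hsol hper hf0 x₀ hx₀ h (Ds x₀) (b := 1) hY heqW
  have hU : IsSmooth (timeRoll τ u) := orbit_isSmooth hsol hper
  have hut := orbit_transversal hsol hper
  have hh0 : ∀ n : ℤ, (𝐜 (𝐰 h)) (n, 0) = 0 := cw_zero_mode (W_zero hW h)
  have hht : ∀ mm : ℤ × (Fin 3 → ℤ), (∑ jj : Fin 3, ((mm.2 jj : ℤ) : ℂ) * ((𝐜 (𝐰 h)) mm) jj) = 0 :=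
    cw_transversal (W_trans hW h)
  -- the rescaled family `ĥ' = τ⁻¹ ĥ`
  obtain ⟨c₀, hc₀⟩ : ∃ c₀ : ℂ, c₀ = ((τ⁻¹ : ℝ) : ℂ) := ⟨_, rfl⟩
  have hh'0 : ∀ n : ℤ, (c₀ • 𝐜 (𝐰 h)) (n, 0) = 0 := fun n => by
    have := hh0 n
    simp only at this
    simp only [Pi.smul_apply, this, smul_zero]
  have hh't : ∀ mm : ℤ × (Fin 3 → ℤ), (∑ jj : Fin 3, ((mm.2 jj : ℤ) : ℂ) * ((c₀ • 𝐜 (𝐰 h)) mm) jj) = 0 := fun mm => by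
    rw [Pi.smul_apply, SteadyLattice.kdot_smul, hht mm, mul_zero]
  have hh'r : RapidDecay (𝐄 (c₀ • 𝐜 (𝐰 h))) := by
    have : (𝐄 (c₀ • 𝐜 (𝐰 h))) = c₀ • (𝐄 (𝐜 (𝐰 h))) := by funext K; rfl
    rw [this]; exact hhr.const_smul c₀
  have heq' : ∀ m : ℤ × (Fin 3 → ℤ), m.2 ≠ 0 →
      (2 * Real.pi * Complex.I * ((τ⁻¹ : ℝ) : ℂ) * (m.1 : ℂ) + ((4 * Real.pi ^ 2 * ν * freqNormSq m.2 : ℝ) : ℂ) +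
          2 * Real.pi * Complex.I * (∑ jj : Fin 3, ((((∫ x, u 0 x) : EuclideanSpace ℝ (Fin 3)) jj : ℝ) : ℂ) * ((m.2 jj : ℤ) : ℂ))) •
          (c₀ • 𝐜 (𝐰 h)) m +
        Torus.lerayCoeff m.2 (𝐍[𝐨[τ, u], c₀ • 𝐜 (𝐰 h)] m + 𝐍[c₀ • 𝐜 (𝐰 h), 𝐨[τ, u]] m) =
        c₀ • ((2 * Real.pi * Complex.I * (m.1 : ℂ)) • 𝐨[τ, u] m) := by
    intro m hm
    have e1 := nl_smul_right c₀ (𝐨[τ, u]) (𝐜 (𝐰 h)) m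
    have e2 := nl_smul_left c₀ (𝐜 (𝐰 h)) (𝐨[τ, u]) m
    have he := heq m hm
    rw [e1, e2, ← smul_add, SteadyLattice.lerayCoeff_smul']
    simp only [Pi.smul_apply, one_smul] at he ⊢
    rw [smul_comm _ c₀, ← smul_add, he]
  obtain ⟨Q, hQ, hE⟩ := linear_rolledUp_of_coeff (U := timeRoll τ u) (m₀ := ∫ x, u 0 x) (h := c₀ • 𝐜 (𝐰 h)) (b := c₀)
    hU hu0 hut hh'0 hh't hh'r heq'
  obtain ⟨hsw, hsq, hdivC, hmeanC, hperw, hEq⟩ := linear_classical (ν := ν) hτ hsol.smooth_velocity hper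
    hh'r.isSmooth_fourierSynth hQ hE (div_synth_eq_zero hh't hh'r) (integral_timeSlice_synth_eq_zero hh'0 hh'r)
  have hτc : (τ : ℂ) ≠ 0 := by exact_mod_cast hτ.ne'
  obtain ⟨t, x, hne⟩ := hR _ _ hsw hsq hdivC hmeanC hperw
  refine hne ?_
  rw [hEq t x, hc₀, Complex.ofReal_inv, inv_mul_cancel₀ hτc, one_smul]

end Linearisation

/-! ## §F⁷ The persistence theorem for mean-zero divergence-free forces -/

section Main

variable {τ : ℝ} {f : UnitAddTorus (Fin 3) → EuclideanSpace ℝ (Fin 3)}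
  {u : ℝ → UnitAddTorus (Fin 3) → EuclideanSpace ℝ (Fin 3)} {p : ℝ → UnitAddTorus (Fin 3) → ℝ}

/-- The norm of `x ∈ W` in terms of the `ℓ²` sum of its coefficients. [folklore] -/
theorem tsum_enorm_sq_toReal_eq (x : W) : (∑' m, ‖(𝐰 x) m‖ₑ ^ 2).toReal = ‖x‖ ^ 2 := by
  rw [← l2_enorm_sq_eq_tsum, ENNReal.toReal_pow, toReal_enorm]
  rfl

/-- **Persistence of the orbit for admissible forces** (the main case of `PeriodicNSOrbitPersists`: `∫ f = 0`,
`div f = 0`; Iooss 1972, §2–3; Henry 1981, Thm. 8.3.2; Kielhöfer 2012, §I.8, §I.12). [folklore] -/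
theorem persists_main (hν : 0 < ν) (hτ : 0 < τ) (hsol : Torus.IsClassicalNSSolutionOn univ ν (fun _ => f) u p)
    (hper : Function.Periodic u τ)
    (hK : ∀ (w : ℝ → UnitAddTorus (Fin 3) → EuclideanSpace ℂ (Fin 3)) (q : ℝ → UnitAddTorus (Fin 3) → ℂ),
        IsSmoothSpaceTimeOn Set.univ w → IsSmoothSpaceTimeOn Set.univ q →
        (∀ t, Torus.IsDivFreeC (w t)) → (∀ t, Torus.HasZeroMean (w t)) → Function.Periodic w τ →
        (∀ t x, timeDerivWithin Set.univ w t x = Torus.linearizedNSOperator ν (u t) (w t) (q t) x) →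
        ∃ z : ℂ, ∀ t x, w t x = z • Torus.realToComplex (timeDerivWithin Set.univ u t x))
    (hR : ∀ (w : ℝ → UnitAddTorus (Fin 3) → EuclideanSpace ℂ (Fin 3)) (q : ℝ → UnitAddTorus (Fin 3) → ℂ),
        IsSmoothSpaceTimeOn Set.univ w → IsSmoothSpaceTimeOn Set.univ q →
        (∀ t, Torus.IsDivFreeC (w t)) → (∀ t, Torus.HasZeroMean (w t)) → Function.Periodic w τ →
        ∃ t x, timeDerivWithin Set.univ w t x ≠ Torus.linearizedNSOperator ν (u t) (w t) (q t) x +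
            Torus.realToComplex (timeDerivWithin Set.univ u t x))
    (hf0 : HasZeroMean f) (hfd : IsDivFree f) {δ : ℝ} (hδ : 0 < δ) :
    ∃ r : ℝ, 0 < r ∧ ∀ f' : UnitAddTorus (Fin 3) → EuclideanSpace ℝ (Fin 3),
      Torus.IsSmooth f' → Torus.IsDivFree f' → Torus.HasZeroMean f' → (∀ x, ‖f' x - f x‖ ≤ r) →
        ∃ (τ' : ℝ) (u' : ℝ → UnitAddTorus (Fin 3) → EuclideanSpace ℝ (Fin 3)) (p' : ℝ → UnitAddTorus (Fin 3) → ℝ), 0 < τ' ∧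
          Torus.IsClassicalNSSolutionOn Set.univ ν (fun _ => f') u' p' ∧ Function.Periodic u' τ' ∧
          ∀ t, (∫ x, ‖u' t x - u (τ / τ' * t) x‖ ^ 2) +
            Torus.gradNormSq (fun x => u' t x - u (τ / τ' * t) x) ≤ δ := by
  -- the state space `W`
  obtain ⟨W, hW, hWc⟩ := exists_space
  haveI : CompleteSpace W := completeSpace_W hWc
  have hf : IsSmooth f := isSmooth_force hsol
  -- the orbit
  have hU : IsSmooth (timeRoll τ u) := orbit_isSmooth hsol hper
  have hu0 : ∀ n : ℤ, 𝐨[τ, u] ((n, 0) : ℤ × (Fin 3 → ℤ)) = 0 := orbit_zero_modes hsol hper hf0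
  have hut := orbit_transversal hsol hper
  have huc := orbit_conj hsol hper
  have hur := orbit_rapidDecay hsol hper
  have hmomx₀ : ∀ N : ℕ, ∑' m : ℤ × (Fin 3 → ℤ), ENNReal.ofReal ((Λ m) ^ N) * ‖(𝐬 (𝐨[τ, u])) m‖ₑ ^ 2 ≠ ⊤ := fun N =>
    moments_of_rapidDecay (C := mFourierCoeff (complexify ∘ fun y => timeRoll τ u y - ∫ x, u 0 x)) hur N
  have hx₀2 : ∑' m : ℤ × (Fin 3 → ℤ), ‖(𝐬 (𝐨[τ, u])) m‖ₑ ^ 2 ≠ ⊤ := by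
    have := hmomx₀ 0; simpa only [pow_zero, ENNReal.ofReal_one, one_mul] using this
  obtain ⟨x₀, hx₀⟩ := exists_memW hW (v := 𝐬 (𝐨[τ, u])) hx₀2 (sw_zero_mode (x := 𝐨[τ, u]) hu0)
    (sw_transversal (x := 𝐨[τ, u]) hut) (sw_neg (x := 𝐨[τ, u]) huc)
  have hcx₀ : 𝐜 (𝐰 x₀) = 𝐨[τ, u] := by rw [hx₀]; exact cw_sw (x := 𝐨[τ, u]) hu0
  -- the time-derivative direction `g = (2πi n) x₀`
  have hg2 : ∑' m : ℤ × (Fin 3 → ℤ),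
      ‖(fun mm : ℤ × (Fin 3 → ℤ) => (2 * Real.pi * Complex.I * (mm.1 : ℂ)) • (𝐬 (𝐨[τ, u])) mm) m‖ₑ ^ 2 ≠ ⊤ := by
    have h1 := tsum_enorm_nsmul_sq_le (𝐬 (𝐨[τ, u])) 0
    simp only [pow_zero, ENNReal.ofReal_one, one_mul, zero_add] at h1
    exact ne_top_of_le_ne_top (ENNReal.mul_ne_top ENNReal.ofReal_ne_top (hmomx₀ 2)) h1
  obtain ⟨g, hg⟩ := exists_memW hW (v := fun mm : ℤ × (Fin 3 → ℤ) => (2 * Real.pi * Complex.I * (mm.1 : ℂ)) • (𝐬 (𝐨[τ, u])) mm)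
    hg2 (nsmul_zero_mode (x := 𝐬 (𝐨[τ, u])) (sw_zero_mode (x := 𝐨[τ, u]) hu0))
    (nsmul_transversal (x := 𝐬 (𝐨[τ, u])) (sw_transversal (x := 𝐨[τ, u]) hut))
    (nsmul_neg (x := 𝐬 (𝐨[τ, u])) (sw_neg (x := 𝐨[τ, u]) huc))
  -- the multipliers and the isomorphism `J = τ⁻¹ Dₛ + L₀`
  obtain ⟨Ds, hDs, -⟩ := exists_diag hW (d := dS) (M := 2 * Real.pi) norm_dS_le dS_neg
  obtain ⟨L₀, hL₀, -⟩ := exists_diag hW (d := dL[ν, ∫ x, u 0 x]) norm_dL_le dL_neg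
  obtain ⟨c₁, hc₁, hcl₁⟩ := exists_symbol_lower_bound (inv_pos.2 hτ) hν (∫ x, u 0 x)
  obtain ⟨J, hJ1, -, -, -⟩ := exists_diagEquiv hW (d := fun mm => ((τ⁻¹ : ℝ) : ℂ) * dS mm + dL[ν, ∫ x, u 0 x] mm)
    (norm_omega_dS_add_dL_le τ⁻¹) (omega_dS_add_dL_neg τ⁻¹) hc₁ (le_norm_omega_dS_add_dL hcl₁)
  have hJ : ∀ h : W, J h = τ⁻¹ • Ds h + L₀ h := fun h => W_ext fun m => by
    rw [hJ1, coeW_add, coeW_smul, Pi.add_apply, Pi.smul_apply, hDs, hL₀, ← Complex.coe_smul, smul_smul, ← add_smul]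
  -- the bilinear map and the compact linearised convection
  obtain ⟨B, hBf, hBb⟩ := exists_bilinear hW
  obtain ⟨K, hK'⟩ : ∃ K : W →L[ℝ] W, ∀ w, K w = B x₀ w + B w x₀ :=
    ⟨(hBb.deriv (x₀, x₀)).comp ((ContinuousLinearMap.id ℝ W).prod (ContinuousLinearMap.id ℝ W)), fun w => by
      simp [IsBoundedBilinearMap.deriv_apply]⟩
  have hx₀w : ∑' m : ℤ × (Fin 3 → ℤ), ENNReal.ofReal ((1 + Λ m) * sobolevWeight 1 m.2) * ‖(𝐜 (𝐰 x₀)) m‖ₑ ≠ ⊤ := by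
    rw [hcx₀]; exact tsum_wt_weight_enorm_ne_top_of_rapidDecay hur
  have hKc : IsCompactOperator K := isCompactOperator_linearised hW hWc hBf x₀ hx₀w K hK'
  -- hypotheses (i), (ii) as kernel and range conditions
  have hker : ∀ h : W, J h + K h = 0 → ∃ z : ℝ, h = z • g := fun h hh =>
    ker_condition hW hDs hL₀ hBf hν hτ hsol hper hf0 hK x₀ hx₀ g hg h (by rw [← hJ h, ← hK' h]; exact hh)
  have hrange : ∀ h : W, J h + K h ≠ Ds x₀ := fun h hh =>
    range_condition hW hDs hL₀ hBf hν hτ hsol hper hf0 hR x₀ hx₀ h (by rw [← hJ h, ← hK' h]; exact hh)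
  -- the local solve
  obtain ⟨ε, hε⟩ : ∃ ε : ℝ, ε = Real.sqrt (δ / (3 * (1 + 4 * Real.pi ^ 2))) := ⟨_, rfl⟩
  have hε0 : 0 < ε := by rw [hε]; exact Real.sqrt_pos.2 (by positivity)
  have hε2 : 3 * (1 + 4 * Real.pi ^ 2) * ε ^ 2 = δ := by
    rw [hε, Real.sq_sqrt (by positivity)]; field_simp
  obtain ⟨δ₁, hδ₁⟩ : ∃ δ₁ : ℝ, δ₁ = min (τ⁻¹ / 2) ε := ⟨_, rfl⟩
  have hδ₁0 : 0 < δ₁ := by rw [hδ₁]; exact lt_min (by positivity) hε0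
  obtain ⟨r₁, hr₁, hsolve⟩ := bordered_local_solve Ds L₀ hBb x₀ τ⁻¹ J hJ K hK' hKc g hker hrange hδ₁0
  -- the force family of the orbit
  have hyf2 : ∀ {F : UnitAddTorus (Fin 3) → EuclideanSpace ℝ (Fin 3)}, IsSmooth F → ∑' m : ℤ × (Fin 3 → ℤ), ‖(𝐲 F) m‖ₑ ^ 2 ≠ ⊤ :=
    fun hF => by have := tsum_moment_yf_ne_top hF 0; simpa only [pow_zero, ENNReal.ofReal_one, one_mul] using this
  obtain ⟨Yf, hYf⟩ := exists_memW hW (v := 𝐲 f) (hyf2 hf) (yf_zero_mode f) (yf_transversal hf hfd) (yf_neg hf.continuous)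
  have hy0 : τ⁻¹ • Ds x₀ + L₀ x₀ + B x₀ x₀ = Yf := by
    refine W_ext fun m => ?_
    by_cases hm : m.2 = 0
    · rw [W_zero' hW _ hm, W_zero' hW _ hm]
    · rw [coord_G hDs hL₀ hBf x₀ τ⁻¹ m, hYf, hcx₀, yf_of_snd_ne_zero f hm]
      exact orbit_equation hsol hper hτ hfd m hm
  -- the radius
  refine ⟨r₁ / 2, by positivity, fun f' hf's hfd' hf0' hclose => ?_⟩
  obtain ⟨Yf', hYf'⟩ := exists_memW hW (v := 𝐲 f') (hyf2 hf's) (yf_zero_mode f') (yf_transversal hf's hfd')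
    (yf_neg hf's.continuous)
  have hdist : ‖Yf' - (τ⁻¹ • Ds x₀ + L₀ x₀ + B x₀ x₀)‖ < r₁ := by
    rw [hy0]
    have h1 : ‖Yf' - Yf‖ ≤ r₁ / 2 := by
      change ‖((Yf' - Yf : W) : lp (fun _ : ℤ × (Fin 3 → ℤ) => EuclideanSpace ℂ (Fin 3)) 2)‖ ≤ r₁ / 2
      refine l2_norm_le_of_tsum_le _ (by positivity) ?_
      have hdf : Continuous fun x => f' x - f x := hf's.continuous.sub hf.continuous
      calc ∑' m, ‖(𝐰 ((Yf' - Yf : W))) m‖ₑ ^ 2 = ∑' m, ‖(𝐲 (fun x => f' x - f x)) m‖ₑ ^ 2 := by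
            refine tsum_congr fun m => ?_
            rw [coeW_sub, Pi.sub_apply, hYf', hYf, yf_sub hf's.continuous hf.continuous]
        _ ≤ ENNReal.ofReal (∫ x, ‖f' x - f x‖ ^ 2) := tsum_enorm_yf_sq_le hdf
        _ ≤ ENNReal.ofReal (r₁ / 2) ^ 2 := by
            rw [← ENNReal.ofReal_pow (by positivity)]
            refine ENNReal.ofReal_le_ofReal ?_
            calc (∫ x, ‖f' x - f x‖ ^ 2) ≤ ∫ x : UnitAddTorus (Fin 3), (r₁ / 2) ^ 2 := by
                  refine integral_mono ((hdf.norm.pow 2).integrable_unitAddTorus) (integrable_const _) fun x => ?_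
                  have := hclose x
                  have h0 := norm_nonneg (f' x - f x)
                  nlinarith
              _ = (r₁ / 2) ^ 2 := by rw [integral_const, probReal_univ, one_smul]
    linarith
  obtain ⟨x, om, hGx, hxx₀, homτ⟩ := hsolve Yf' hdist
  have hom : 0 < om := by
    have h1 := (abs_lt.1 homτ).1
    have h2 : δ₁ ≤ τ⁻¹ / 2 := by rw [hδ₁]; exact min_le_left _ _
    have h3 : 0 < τ⁻¹ := inv_pos.2 hτ
    linarith
  -- the unscaled family `c = x/Λ`
  have hc0 : ∀ n : ℤ, (𝐜 (𝐰 x)) (n, 0) = 0 := cw_zero_mode (W_zero hW x)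
  have hct : ∀ mm : ℤ × (Fin 3 → ℤ), (∑ jj : Fin 3, ((mm.2 jj : ℤ) : ℂ) * ((𝐜 (𝐰 x)) mm) jj) = 0 :=
    cw_transversal (W_trans hW x)
  have hcs : ∀ mm : ℤ × (Fin 3 → ℤ), (𝐜 (𝐰 x)) (-mm) = conjVec ((𝐜 (𝐰 x)) mm) := cw_neg (W_conj hW x)
  have hceq : ∀ m : ℤ × (Fin 3 → ℤ), m.2 ≠ 0 →
      (2 * Real.pi * Complex.I * (om : ℂ) * (m.1 : ℂ) + ((4 * Real.pi ^ 2 * ν * freqNormSq m.2 : ℝ) : ℂ) +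
          2 * Real.pi * Complex.I * (∑ jj : Fin 3, ((((∫ x, u 0 x) : EuclideanSpace ℝ (Fin 3)) jj : ℝ) : ℂ) * ((m.2 jj : ℤ) : ℂ))) •
          (𝐜 (𝐰 x)) m +
        Torus.lerayCoeff m.2 (𝐍[𝐜 (𝐰 x), 𝐜 (𝐰 x)] m) = if m.1 = 0 then mFourierCoeff (complexify ∘ f') m.2 else 0 := by
    intro m hm
    have h1 := congrArg (fun z : W => (𝐰 z) m) hGx
    simp only at h1
    rw [coord_G hDs hL₀ hBf x om m, hYf', yf_of_snd_ne_zero f' hm] at h1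
    exact h1
  -- regularity of `c`
  obtain ⟨c₂, hc₂, hcl₂⟩ := exists_symbol_lower_bound hom hν (∫ x, u 0 x)
  have hmomX₀ : ∀ N : ℕ, ∑' m, ENNReal.ofReal ((Λ m) ^ N) * ‖(𝐰 x₀) m‖ₑ ^ 2 ≠ ⊤ := by
    intro N; rw [hx₀]; exact hmomx₀ N
  have hineq : ∀ m : ℤ × (Fin 3 → ℤ), m.2 ≠ 0 →
      c₂ * ‖(𝐰 x) m‖ ≤ ‖(𝐲 f') m‖ + ‖𝐍[𝐜 (𝐰 x), 𝐜 (𝐰 x)] m‖ + ‖𝐍[𝐜 (𝐰 x₀), 𝐜 (𝐰 x)] m‖ +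
        ‖𝐍[𝐜 (𝐰 x), 𝐜 (𝐰 x₀)] m‖ := by
    intro m hm
    have he := hceq m hm
    have hL : (Λ m) ≠ 0 := ne_of_gt (lt_of_lt_of_le one_pos (one_le_wt hm))
    have hxm : ‖(𝐰 x) m‖ = Λ m * ‖(𝐜 (𝐰 x)) m‖ := by
      have e1 : ‖(𝐜 (𝐰 x)) m‖ = (Λ m)⁻¹ * ‖(𝐰 x) m‖ := by
        change ‖((((Λ m)⁻¹ : ℝ)) : ℂ) • (𝐰 x) m‖ = _
        rw [norm_smul, Complex.norm_real, Real.norm_of_nonneg (inv_nonneg.2 (wt_nonneg m))]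
      rw [e1, ← mul_assoc, mul_inv_cancel₀ hL, one_mul]
    have hσ := hcl₂ m hm
    have h1 : ‖σ[om, ν, ∫ x, u 0 x] m • (𝐜 (𝐰 x)) m‖ ≤ ‖(𝐲 f') m‖ + ‖𝐍[𝐜 (𝐰 x), 𝐜 (𝐰 x)] m‖ := by
      rw [show σ[om, ν, ∫ x, u 0 x] m • (𝐜 (𝐰 x)) m = (𝐲 f') m - Torus.lerayCoeff m.2 (𝐍[𝐜 (𝐰 x), 𝐜 (𝐰 x)] m) by
        rw [yf_of_snd_ne_zero f' hm, ← he]; exact (add_sub_cancel_right _ _).symm]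
      exact (norm_sub_le _ _).trans (add_le_add le_rfl (SteadyLattice.norm_lerayCoeff_le _ _))
    rw [norm_smul] at h1
    have h0 : 0 ≤ ‖𝐍[𝐜 (𝐰 x₀), 𝐜 (𝐰 x)] m‖ := norm_nonneg _
    have h0' : 0 ≤ ‖𝐍[𝐜 (𝐰 x), 𝐜 (𝐰 x₀)] m‖ := norm_nonneg _
    calc c₂ * ‖(𝐰 x) m‖ = (c₂ * Λ m) * ‖(𝐜 (𝐰 x)) m‖ := by rw [hxm]; ring
      _ ≤ ‖σ[om, ν, ∫ x, u 0 x] m‖ * ‖(𝐜 (𝐰 x)) m‖ := mul_le_mul_of_nonneg_right hσ (norm_nonneg _)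
      _ ≤ _ := by linarith
  have hmomc := moments_of_lattice_ineq hc₂ (𝐰 x) (𝐰 x₀) (𝐲 f') (W_zero hW x) (W_zero hW x₀) (l2_tsum_enorm_sq_ne_top _)
    hmomX₀ (tsum_moment_yf_ne_top hf's) hineq
  have hcr : RapidDecay (𝐄 (𝐜 (𝐰 x))) := rapidDecay_of_moments (W_zero hW x) hmomc
  -- realization
  obtain ⟨p', hsol', hper'⟩ := realize_nonlinear (ν := ν) (m₀ := ∫ x, u 0 x) (F := f') (c := 𝐜 (𝐰 x)) hom hf's hfd' hf0'
    hc0 hct hcs hcr hceq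
  refine ⟨om⁻¹, _, p', inv_pos.2 hom, hsol', hper', fun t => ?_⟩
  -- the closeness estimate via the slice `H¹` bound
  obtain ⟨hV's, -, hVcoef⟩ := realSynth_spec' hcr (ext_neg_eq_conjVec (c := 𝐜 (𝐰 x)) hcs)
  obtain ⟨D, hDdef⟩ : ∃ D : UnitAddTorus (Fin 4) → EuclideanSpace ℝ (Fin 3),
      D = fun y => EuclideanSpace.realPart (fourierSynth (𝐄 (𝐜 (𝐰 x))) y) - (timeRoll τ u y - ∫ x, u 0 x) := ⟨_, rfl⟩
  have hV : IsSmooth (fun y => timeRoll τ u y - ∫ x, u 0 x) := hU.sub (isSmooth_const _)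
  have hD : IsSmooth D := by rw [hDdef]; exact hV's.sub hV
  have he0 : ∀ n : ℤ, (𝐰 ((x - x₀ : W))) (n, 0) = 0 := W_zero hW _
  have he2 : ∑' m, ‖(𝐰 ((x - x₀ : W))) m‖ₑ ^ 2 ≠ ⊤ := l2_tsum_enorm_sq_ne_top _
  have he : ∀ m : ℤ × (Fin 3 → ℤ), mFourierCoeff (complexify ∘ D) (Fin.cons m.1 m.2) = (𝐜 (𝐰 ((x - x₀ : W)))) m := by
    intro m
    have hsplit : (complexify ∘ D) = (complexify ∘ fun y => EuclideanSpace.realPart (fourierSynth (𝐄 (𝐜 (𝐰 x))) y)) -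
        (complexify ∘ fun y => timeRoll τ u y - ∫ x, u 0 x) := by
      funext y; simp [hDdef]
    have hVc : IsSmooth (complexify ∘ fun y => timeRoll τ u y - ∫ x, u 0 x) := hV.comp_clm complexify.toContinuousLinearMap
    have hRc : IsSmooth (complexify ∘ fun y => EuclideanSpace.realPart (fourierSynth (𝐄 (𝐜 (𝐰 x))) y)) :=
      hV's.comp_clm complexify.toContinuousLinearMap
    rw [hsplit, mFourierCoeff_sub hRc.integrable hVc.integrable, hVcoef, coeW_sub]
    have e1 := congrArg (fun F : ℤ × (Fin 3 → ℤ) → EuclideanSpace ℂ (Fin 3) => F m) hcx₀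
    simp only at e1
    simp only [Fin.cons_zero, Fin.tail_cons, Prod.mk.eta, Pi.sub_apply, smul_sub]
    rw [← e1]
  have hbound := slice_h1_le hD (𝐰 ((x - x₀ : W))) he0 he he2 (((om * t : ℝ)) : UnitAddCircle)
  have hnorm : (∑' m, ‖(𝐰 ((x - x₀ : W))) m‖ₑ ^ 2).toReal = ‖x - x₀‖ ^ 2 := tsum_enorm_sq_toReal_eq _
  rw [hnorm] at hbound
  -- identify the slice with `u'(t) − u(τ/τ' t)`
  have hfun : (fun x' : UnitAddTorus (Fin 3) => ((∫ x, u 0 x) + EuclideanSpace.realPart (fourierSynth (𝐄 (𝐜 (𝐰 x)))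
      (Fin.cons (((om * t : ℝ)) : UnitAddCircle) x'))) - u (τ / om⁻¹ * t) x') = timeSlice D (((om * t : ℝ)) : UnitAddCircle) := by
    funext x'
    rw [timeSlice_apply, hDdef]
    simp only
    rw [timeRoll_cons hper (om * t) x', show τ / om⁻¹ * t = τ * (om * t) by rw [div_inv_eq_mul, mul_assoc]]
    abel
  have hδ₁ε : δ₁ ≤ ε := by rw [hδ₁]; exact min_le_right _ _
  have hxx : ‖x - x₀‖ ^ 2 ≤ ε ^ 2 := by
    have := hxx₀.le.trans hδ₁ε
    exact pow_le_pow_left₀ (norm_nonneg _) this 2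
  calc (∫ x', ‖((∫ x, u 0 x) + EuclideanSpace.realPart (fourierSynth (𝐄 (𝐜 (𝐰 x)))
          (Fin.cons (((om * t : ℝ)) : UnitAddCircle) x'))) - u (τ / om⁻¹ * t) x'‖ ^ 2) +
        Torus.gradNormSq (fun x' => ((∫ x, u 0 x) + EuclideanSpace.realPart (fourierSynth (𝐄 (𝐜 (𝐰 x)))
          (Fin.cons (((om * t : ℝ)) : UnitAddCircle) x'))) - u (τ / om⁻¹ * t) x')
      = (∫ x', ‖timeSlice D (((om * t : ℝ)) : UnitAddCircle) x'‖ ^ 2) +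
          Torus.gradNormSq (timeSlice D (((om * t : ℝ)) : UnitAddCircle)) := by
        rw [← hfun]
    _ ≤ (3 * (1 + 4 * Real.pi ^ 2)) * ‖x - x₀‖ ^ 2 := hbound
    _ ≤ (3 * (1 + 4 * Real.pi ^ 2)) * ε ^ 2 := by gcongr
    _ = δ := hε2

end Main

/-! ## §G⁷ Degenerate forces and the discharge -/

section Degenerate

variable {f : UnitAddTorus (Fin 3) → EuclideanSpace ℝ (Fin 3)}

/-- **No admissible force near a force with nonzero mean**: if `∫ f ≠ 0` then no mean-zero `f'`
satisfies `‖f' − f‖_∞ ≤ ‖∫f‖/2`. [folklore] -/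
theorem no_admissible_force_of_not_hasZeroMean (hf : IsSmooth f) (hf0 : ¬ HasZeroMean f) :
    ∃ r : ℝ, 0 < r ∧ ∀ f' : UnitAddTorus (Fin 3) → EuclideanSpace ℝ (Fin 3),
      IsSmooth f' → HasZeroMean f' → (∀ x, ‖f' x - f x‖ ≤ r) → False := by
  have hpos : 0 < ‖∫ x, f x‖ := norm_pos_iff.2 hf0
  refine ⟨‖∫ x, f x‖ / 2, by positivity, fun f' hf' hf0' hclose => ?_⟩
  have h1 : (∫ x, f x) = ∫ x, (f x - f' x) := by
    rw [integral_sub hf.integrable hf'.integrable, show (∫ x, f' x) = 0 from hf0', sub_zero]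
  have h2 : ‖∫ x, (f x - f' x)‖ ≤ ‖∫ x, f x‖ / 2 := by
    refine (norm_integral_le_integral_norm _).trans ?_
    calc (∫ x, ‖f x - f' x‖) ≤ ∫ x : UnitAddTorus (Fin 3), ‖∫ x, f x‖ / 2 := by
          refine integral_mono (hf.integrable.sub hf'.integrable).norm (integrable_const _) fun x => ?_
          rw [← norm_neg, neg_sub]; exact hclose x
      _ = ‖∫ x, f x‖ / 2 := by rw [integral_const, probReal_univ, one_smul]
  rw [← h1] at h2
  linarith

/-- **No admissible force near a non-solenoidal force**: if `div f ≠ 0` then some coefficient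
`k · f̂(k)` is nonzero and no divergence-free `f'` is `L²`-close to `f` (Parseval). [folklore] -/
theorem no_admissible_force_of_not_isDivFree (hf : IsSmooth f) (hfd : ¬ IsDivFree f) :
    ∃ r : ℝ, 0 < r ∧ ∀ f' : UnitAddTorus (Fin 3) → EuclideanSpace ℝ (Fin 3),
      IsSmooth f' → IsDivFree f' → (∀ x, ‖f' x - f x‖ ≤ r) → False := by
  have hex : ∃ k : Fin 3 → ℤ, (∑ j : Fin 3, ((k j : ℤ) : ℂ) * mFourierCoeff (complexify ∘ f) k j) ≠ 0 := by
    by_contra h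
    simp only [not_exists, not_not] at h
    exact hfd (isDivFree_of_sum_mul_mFourierCoeff_eq_zero hf h)
  obtain ⟨k, hk⟩ := hex
  set A : ℝ := ‖∑ j : Fin 3, ((k j : ℤ) : ℂ) * mFourierCoeff (complexify ∘ f) k j‖ with hA
  have hA0 : 0 < A := norm_pos_iff.2 hk
  have hw0 : 0 < sobolevWeight 1 k := sobolevWeight_pos 1 k
  refine ⟨A / (6 * sobolevWeight 1 k), by positivity, fun f' hf' hfd' hclose => ?_⟩
  have hdf : Continuous fun x => f x - f' x := hf.continuous.sub hf'.continuous
  -- the coefficient of the difference is small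
  have hcoef : ‖mFourierCoeff (complexify ∘ fun x => f x - f' x) k‖ ≤ A / (6 * sobolevWeight 1 k) := by
    have hpar := tsum_enorm_sq_mFourierCoeff_euclidean (continuous_complexify.comp hdf)
    have hnorm : (∫ x, ‖(complexify ∘ fun x => f x - f' x) x‖ ^ 2) = ∫ x, ‖f x - f' x‖ ^ 2 := by
      congr 1; funext x; rw [Function.comp_apply, norm_complexify]
    rw [hnorm] at hpar
    have h1 : ‖mFourierCoeff (complexify ∘ fun x => f x - f' x) k‖ₑ ^ 2 ≤
        ENNReal.ofReal (A / (6 * sobolevWeight 1 k)) ^ 2 := by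
      calc ‖mFourierCoeff (complexify ∘ fun x => f x - f' x) k‖ₑ ^ 2
          ≤ ∑' k', ‖mFourierCoeff (complexify ∘ fun x => f x - f' x) k'‖ₑ ^ 2 := ENNReal.le_tsum k
        _ = ENNReal.ofReal (∫ x, ‖f x - f' x‖ ^ 2) := hpar
        _ ≤ ENNReal.ofReal (A / (6 * sobolevWeight 1 k)) ^ 2 := by
            rw [← ENNReal.ofReal_pow (by positivity)]
            refine ENNReal.ofReal_le_ofReal ?_
            calc (∫ x, ‖f x - f' x‖ ^ 2) ≤ ∫ x : UnitAddTorus (Fin 3), (A / (6 * sobolevWeight 1 k)) ^ 2 := by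
                  refine integral_mono ((hdf.norm.pow 2).integrable_unitAddTorus) (integrable_const _) fun x => ?_
                  have := hclose x
                  rw [← norm_neg, neg_sub] at this
                  have h0 := norm_nonneg (f x - f' x)
                  nlinarith
              _ = (A / (6 * sobolevWeight 1 k)) ^ 2 := by rw [integral_const, probReal_univ, one_smul]
    have h2 : ‖mFourierCoeff (complexify ∘ fun x => f x - f' x) k‖ₑ ≤ ENNReal.ofReal (A / (6 * sobolevWeight 1 k)) :=
      (ENNReal.pow_le_pow_left_iff two_ne_zero).1 h1
    rwa [← ofReal_norm, ENNReal.ofReal_le_ofReal_iff (by positivity)] at h2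
  -- but it carries the whole of `k · f̂(k)`
  have hsub : mFourierCoeff (complexify ∘ fun x => f x - f' x) k = mFourierCoeff (complexify ∘ f) k - mFourierCoeff (complexify ∘ f') k := by
    have e : (complexify ∘ fun x => f x - f' x) = (complexify ∘ f) - (complexify ∘ f') := by funext x; simp
    have hfc : IsSmooth (complexify ∘ f) := hf.comp_clm complexify.toContinuousLinearMap
    have hfc' : IsSmooth (complexify ∘ f') := hf'.comp_clm complexify.toContinuousLinearMap
    rw [e, mFourierCoeff_sub hfc.integrable hfc'.integrable]
  have hk' : (∑ j : Fin 3, ((k j : ℤ) : ℂ) * mFourierCoeff (complexify ∘ f) k j) =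
      ∑ j : Fin 3, ((k j : ℤ) : ℂ) * mFourierCoeff (complexify ∘ fun x => f x - f' x) k j := by
    rw [hsub, SteadyLattice.kdot_sub', hfd'.sum_mul_mFourierCoeff_eq_zero hf' k, sub_zero]
  have hle : A ≤ A / 2 := by
    calc A = ‖∑ j : Fin 3, ((k j : ℤ) : ℂ) * mFourierCoeff (complexify ∘ fun x => f x - f' x) k j‖ := by rw [hA, hk']
      _ ≤ 3 * sobolevWeight 1 k * ‖mFourierCoeff (complexify ∘ fun x => f x - f' x) k‖ := SteadyLattice.norm_kdot_le k _
      _ ≤ 3 * sobolevWeight 1 k * (A / (6 * sobolevWeight 1 k)) := by gcongr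
      _ = A / 2 := by field_simp; ring
  linarith

end Degenerate

end Multipliers

end TimePeriodicLattice

/-- **Discharge of `PeriodicNSOrbitPersists`** (Henry 1981, Thm. 8.3.2 with Ex. 6 of §8.3, for the Navier–Stokes
system on `T³`; Iooss 1972, §2–3; Kielhöfer 2012, §I.8, §I.12): persistence of a classical
time-periodic orbit with simple Floquet multiplier `1` under sup-norm perturbation of the force,
proved on the space–time Fourier lattice (see the module docstring); forces with nonzero mean or
nonzero divergence admit no admissible perturbation `f'`. [cite: Henry1981, Thm. 8.3.2] -/
theorem PeriodicNSOrbitPersists_holds : PeriodicNSOrbitPersists := by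
  intro ν τ f u p hν hτ hsol hper hK hR δ hδ
  have hf : FunctionSpaces.Torus.IsSmooth f := TimePeriodicLattice.isSmooth_force hsol
  by_cases hf0 : FunctionSpaces.Torus.HasZeroMean f
  · by_cases hfd : FunctionSpaces.Torus.IsDivFree f
    · exact TimePeriodicLattice.persists_main hν hτ hsol hper hK hR hf0 hfd hδ
    · obtain ⟨r, hr, hno⟩ := TimePeriodicLattice.no_admissible_force_of_not_isDivFree hf hfd
      exact ⟨r, hr, fun f' hf' hfd' _ hclose => (hno f' hf' hfd' hclose).elim⟩
  · obtain ⟨r, hr, hno⟩ := TimePeriodicLattice.no_admissible_force_of_not_hasZeroMean hf hf0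
    exact ⟨r, hr, fun f' hf' _ hf0' hclose => (hno f' hf' hf0' hclose).elim⟩

end Literature.Analysis.FluidPDE
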